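import Summits.QuantumFields.BalabanUV.Beta.FP.TowerKernelLawNamedC
import Summits.QuantumFields.BalabanUV.Beta.FP.StepRecursionFeedNestedComp
import Summits.QuantumFields.BalabanUV.Beta.FP.TowerHSideRowsClosing
import Summits.QuantumFields.BalabanUV.Beta.FP.TowerNParityRowsEven
import Summits.QuantumFields.BalabanUV.Beta.FP.WoundEvenFamilyParities
import Summits.QuantumFields.BalabanUV.Beta.FP.TowerNSlotLetters
import Summits.QuantumFields.BalabanUV.Beta.FP.TowerH2Letters
import Summits.QuantumFields.BalabanUV.Beta.FP.TowerN1RowsFamily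
import Summits.QuantumFields.BalabanUV.Beta.FP.TowerHN2RowMixedWard
import Summits.QuantumFields.BalabanUV.Beta.FP.TowerK1RowTopColumn
import Summits.QuantumFields.BalabanUV.Beta.FP.TowerHLinkRows
import Summits.QuantumFields.BalabanUV.Beta.FP.TorusCompositeNestedJetsSym
import Summits.QuantumFields.BalabanUV.Beta.NVertexLamFold
import Summits.QuantumFields.BalabanUV.Beta.FP.TowerLamSourceDisplay
import Summits.QuantumFields.BalabanUV.Beta.CombWilsonT2EvenPairRow
import Summits.QuantumFields.BalabanUV.Beta.FP.TorusWJunctionOfNLeg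

/-!
# `BalabanUV.Beta.FP.StepRecursionFeedNestedNamedF` — road «FP», binder row D1, ROUTE T (β1): **THE END WRAPPER v7 — v6 `…NamedE.d1Tel_JcComp_ctr_namedE` WITH (J-ΛS), (J-X₂)
# AND (J-W″) DISCHARGED AND THE TREE-GAUGE READ-OUT PINNED** (`g46/SPEC-58.md` §5, `g47/SPEC-59.md`): (J-ΛS) `hΛS` is fed by `TowerLamSourceDisplay.hΛS_of_road_data` (an2 PART 29 on
# the `ff` block + (J-Λ)) at the PINNED coefficient `cΛS := Pn.cΛ (n+2)` (Λ-lock `hLk : c·Pn.cΛ(n+2) = cM₂·r·κ₂`); (J-X₂) `hX₂` by an2 PART 27 `CombWilsonT2EvenPairRow.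
# torus_T2evenPair_pureGauge_snd_fun` under ONE table pin `hTW : Pn.T (n+2) = (8N²)⁻¹ • wsym22 N`, `2 ≤ N`; the read-out `lv` is PINNED (`hlve`) to g39 `TorusWJunctionOfNLeg.
# hv_single_apply_eq_of_NLeg_sym`'s explicit form (minus the one-shot big-comb integral of the nested column's tower modes `(P·W₀)⁻¹(P·hv v)`), so its linearity `hlv` and the
# letter (J-W″) `hJW` are theorems of the displayed (S3-1) N system; everything else v6 VERBATIM (v5's rows `hHN₁ hQN₁ hHN₂ hQN₂`, `hcf hκ hκn hbl hbtop K1 hlink`, letters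
# `hXbf hH₂l hH₂r hH₂t hfN hmN hcN`, (J-Λ-fold) are THEOREMS inside; DISPLAYED: the pins `hr hdv hlve hXbf hfN hcfe hhbe hκe hwe hTW hH₂f` over the tables `hT₂ hM₂` and columns
# `hm hml hJM`, the scalar LOCKS `hcVH hcΛ hcB hcE₂ hcM₂ hLk`, the mixed table's Ward row (K2b) `hK2b` with its site-remainder family `Rs`, the residual row (J-R₂) `hR₂`; `a2`,
# winding letters, (S3-1), F ∕ G rows v5 VERBATIM)

WHY.  v6 displayed three rows that are theorems of the tree; v7 is the ONE re-packaging that removes them.  Generated from the TREE bytes of v5 (34380d82733eff77) by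
`g47/gen/genV7.py` (`genV6b.py` lineage); does NOT import v6 ∕ v5 (gate `dedup.landed` rule, journal [D1P3-G46-CORR-1]): the proof is v5's OWN law feed
(`hessKer_law_tower_namedC` + END-Comp) with the discharged rows bound by `have`s.  [folklore] packaging BY NAME; no `def`, no `def … : Prop`, nothing cited, 0 sorry.
HONEST: every pin ∕ lock ∕ Ward ∕ residual row is a HYPOTHESIS (junction condition on the free pins ∕ the literal); `hTW` pins the composite jet data's Wilson table to an2's
symmetric-block table — a junction condition like the locks, not a valuation.  BY-VALUE ∕ KERNEL STATUS OF THE TWO REMAINING H-SIDE ROWS (zero weight): (K2b) with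
`Rs = 0` is inhabited at DEPTH 1 only (`κ₂ = −1`; an2 PART 25∕26, Engine C K2L TIER M); at the COMPOSITE depths of this wrapper (`tabsComp (n+2)`) the STOREYWISE
commutator holds (K2L TIER V-A; an2 PART 30–33) — which IS this display with `κ₂ = −wM2` and `Rs :=` the transport-variation word `ℓ̃(b;x)·(λ(x.1) − λ(root b))` on
either leg of the top brick (road [D1P3-G47-ONLINE]) — so (J-R₂), the `Ŝ`-contraction of that word at the road's OWN read-outs `λ_a = lv (r•e_a)`, CARRIES THE CONTENT;
for GENERIC gauge functions it does not vanish at n = 0 (K2L TIER V-B); at `λ_a` it is R-AN2-70-K2L-ADD3 (road GO, PREDICTION-FP-47: negative).  IF NEGATIVE, v5's row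
`hHN₂` is false at n = 0 for the literal as typed and #21's order-2 gauge door `hH′₂f` (plain conjugation by the finest diagonal generator) vs the typed composite's
storeywise covariance is a LAW-LEVEL question (Q-FP-47-1, REFEREE ∕ leaf-06).  This theorem is CONDITIONAL on every displayed row either way; nothing of Bałaban's
asserted, valued or discharged; 0 estimates; 0∕4 row-D1 binders (hW, hR, D1Tel, D1Rep); ROOT M‴ p325680 ∕ P5c ∕ D6 untouched; NOT (C1), NOT (L2′), NOT (T-ID), NOT SDF,
NOT D1, NOT BetaPertH, NOT continuum, NOT Clay.  v5 ∕ v6 stay (consumers choose).  HONEST DEPENDENCY (page 1, mandatory): continuum YM on T⁴ ⇐ BetaPertH ∧ nine spine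
estimates (0/9 proved); BetaPertH ⇐ (D1) ∧ (D4) ∧ CAP+tail; G-an2-4 gates asym, D1 and NE2/3/4.  HONEST FRAMING (cell contract, verbatim): «discharging `BetaPertH` makes
Bałaban's UV stability UNCONDITIONAL — a real constructive-QFT result; it is NOT the continuum limit and NOT the Clay problem.»  ABSOLUTE RULE (cell charter, verbatim):
«No internally-minted statement may enter as a cited fact. Every hypothesis is either kernel-proved in this package or a verbatim quotation of a PUBLISHED theorem with
page reference. The manuscript(s) under audit are NOT citable for their own disputed steps — they are the thing under adjudication; programme-internal (2001/route/tribunal)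
claims are never citable.»  Road «FP» OWNER, b2b-balaban-beta-d1-p3 gen 47, 2026-08-28.  No existing file touched.
-/

noncomputable section

open scoped BigOperators Matrix Topology

namespace Summit.QuantumFields.BalabanUV.Beta.FP.StepRecursionFeedNestedNamedF

open Matrix Finset Filter
open Literature.Probability.LatticeModels (Torus.proj)
open Literature.MathematicalPhysics.QuantumFieldTheory.Balaban1983to89
open Literature.MathematicalPhysics.QuantumFieldTheory.Balaban1983to89.Beta
open Literature.MathematicalPhysics.QuantumFieldTheory.Balaban1983to89.Beta.Composition (kkt)
open Literature.MathematicalPhysics.QuantumFieldTheory.Balaban1983to89.Beta.CompositionSingular (effForm flucCov minOp minOpL)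
open B4TorusKernel.MultiPeriod (translate)  open B5Prop11Plancherel (fine)  open B6Lemma24Torus (pbox mem_pbox)  open AffineAveraging (Site box toSite unitVec)
open AveragingContoursRooted (ctr ctrOff ctrOff_mem_box)
open OneStepResolventKernel (Fib)
open ExpKernelCalculus (MKer Decays BiLoc VertexFamily VertexFamily₂ shiftK hessKer)
open BalabanStepJetsSucc (wVH)
open Summit.QuantumFields.BalabanUV.Beta.AxialDressingRooted (axEc)
open Summit.QuantumFields.BalabanUV.Beta.BorderedHessian (stepScale)
open Summit.QuantumFields.BalabanUV.Beta.D1BFx.LogDetSecondVariation (secondVar)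
open Summit.QuantumFields.BalabanUV.Beta.FP.KernelPeriodisationFib (Idx perF)
open Summit.QuantumFields.BalabanUV.Beta.SymAveragingHessianCounts (symVhSAt)
open Summit.QuantumFields.BalabanUV.Beta.SymAveragingMixedJetTables (symVh₂SAt)
open Summit.QuantumFields.BalabanUV.Beta.SymShiftedSpread (bhKStepSh)
open Summit.QuantumFields.BalabanUV.Beta.DshAn1 (Dsh)
open Summit.QuantumFields.BalabanUV.Beta.CombChartStepJets (GcombSh)
open Summit.QuantumFields.BalabanUV.Beta.FP.KernelPeriodisationFibLoc (dper)
open Summit.QuantumFields.BalabanUV.Beta.FP.TorusCombRows (Res)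
open Summit.QuantumFields.BalabanUV.Beta.FP.TorusGaugeCovariance (tgrad tdelta)
open Summit.QuantumFields.BalabanUV.Beta.FP.TorusCompositeObjects (towerTorus NParam combF bigP towerGen)  open Summit.QuantumFields.BalabanUV.Beta.FP.TorusCompositeObjectsG (QSym compRowsSym nestedSliceSym)
open Summit.QuantumFields.BalabanUV.Beta.FP.TorusCompositeFP (evalN)
open Summit.QuantumFields.BalabanUV.Beta.GAN24.FineReadoutCauchyFrame (toSite_mem_range)
open Summit.QuantumFields.BalabanUV.Beta.FP.TorusCompositeSliceG (det_nestedSliceSym_mul_towerGen_ne_zero)  open Summit.QuantumFields.BalabanUV.Beta.FP.TorusCompositeSliceOneShotG (torus_hTW_oneShot_towerSym)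
open Summit.QuantumFields.BalabanUV.Beta.FP.TorusCompositeCovarianceSym (compRowsSym_mul_towerGen_succ QtopSym_mul_smul_tgrad_res)  open Summit.QuantumFields.BalabanUV.Beta.FP.TorusCompositeCovarianceOneSym (compIns₁Sym)
open Summit.QuantumFields.BalabanUV.Beta.FP.TorusCompositeCovarianceTwoPolarSym (compIns₂₂Sym)  open Summit.QuantumFields.BalabanUV.Beta.FP.TorusCompositeCovarianceOneRowsSym (torus_c1_towerSym torus_d1_towerSym)
open Summit.QuantumFields.BalabanUV.Beta.FP.TorusCompositeCovarianceTwoRowsSym (torus_d2_towerSym)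
open Summit.QuantumFields.BalabanUV.Beta.FP.TorusCompositeRowsDirectionalSym (Q11f_lin Q21f_lin Q12f_lin_left Q12f_lin_right Q22f_lin_left Q22f_lin_right
  torus_c2_towerSym_polar)
open Summit.QuantumFields.BalabanUV.Beta.FP.NestedStepLawTorusInstance (dvd_fine)
open Summit.QuantumFields.BalabanUV.Beta.FP.PackedLegCombSym (kkt_mul_inv_combSym packedLeg_combSym_eq perF_rules_combSym lattice_letters_combSym)
open Summit.QuantumFields.BalabanUV.Beta.FP.TowerKernelLawSymB (hessKer_law_tower_sym)
open Summit.QuantumFields.BalabanUV.Beta.FP.TowerUTopClosedSym (nestedColumn_linear)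
open Summit.QuantumFields.BalabanUV.Beta.FP.TowerUTopClosedSymB (torus_uTop_towerSym_closed)
open DressedMomentNormalisation (EKer dressedEntry)
open OneStepKernelFamily (TshotOf TbalOf D1Tel)
open HessianTelescopingKKT (wStep)
open Summit.QuantumFields.BalabanUV.Beta.SymSecondOrderTablesAn1 (symTablesAn1S2)
open Summit.QuantumFields.BalabanUV.Beta.CombChartJointEnd (JsB12CombShSym)
open Summit.QuantumFields.BalabanUV.Beta.CompositeOneShotJetData (Roots Pins JcComp AN VN WN)
open Summit.QuantumFields.BalabanUV.Beta.CompositeOneShotJets (decays_compChart shiftK_compChart)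
open Summit.QuantumFields.BalabanUV.Beta.FP.TorusGaugeCovarianceCoarse (coarsePt)
open Summit.QuantumFields.BalabanUV.Beta.FP.NestedStepLawTorusInstance (coarseSlot_injective coarseSlot_range)
open Summit.QuantumFields.BalabanUV.Beta.FP.StepRecursionFeedNestedComp (d1Tel_JcComp_ctr_nested_of_hessKer_laws_wStep)
open Summit.QuantumFields.BalabanUV.Beta.FP.TowerKernelLawNamedC (hessKer_law_tower_namedC)
open Summit.QuantumFields.BalabanUV.Beta.FP.WoundEvenFamilyParities (hWNm_rows_wound hWNt_rows_wound)
open Summit.QuantumFields.BalabanUV.Beta.FP.TowerHSideRowsClosing (H1f_linear H1f_transpose a1_row)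
open InterLevelTransport (SLam)  open StepJetData (wilsonA)
open Summit.QuantumFields.BalabanUV.Beta.SymAveragingHessianCounts (symHessFFAt symLinKerAt)
open Summit.QuantumFields.BalabanUV.Beta.BorderedHessian (bhKStepAt)
open Summit.QuantumFields.BalabanUV.Beta.FP.TorusCompositeCompanionSumG (compSumSym)  open Summit.QuantumFields.BalabanUV.Beta.FP.TorusCompositeCompanionFamilyG (onTowerFamily)

open Summit.QuantumFields.BalabanUV.Beta.TameKernelCalculus (trK)  open Summit.QuantumFields.BalabanUV.Beta.BorderedHessian (sgnK)
open Summit.QuantumFields.BalabanUV.Beta.GAN24.SecondOrderCarrierParity (vertexFamily₂_evenHalf_of_swap)  open Summit.QuantumFields.BalabanUV.Beta.FP.TowerNParityRowsEven (WN_swap hWNm_rows_even hWNt_rows_even WN_even_submatrix_ff WN_even_submatrix_μf hessKer_WN_even)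

open Summit.QuantumFields.BalabanUV.Beta.FP.TowerHN2Row (hHN2_family_of_locks_of_junctions)  open Summit.QuantumFields.BalabanUV.Beta.FP.TowerHN2RowMixed (hJΛ2_of_mixedLock_of_mixedGauge)
open Summit.QuantumFields.BalabanUV.Beta.FP.TowerNSlotLetters (towerSlot_injective towerSlot_range Xbf_linear_of_pin)
open Summit.QuantumFields.BalabanUV.Beta.FP.TowerH2Letters (H2f_linear_left H2f_linear_right H2f_transpose H2f_half_symm_eq)
open Summit.QuantumFields.BalabanUV.Beta.FP.TowerN1RowsFamily (hHN1_family_of_road_data hQN1_family_of_road_data)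
open Summit.QuantumFields.BalabanUV.Beta.FP.TowerQN2RowFamily (hQN2_family_of_lock)
open Summit.QuantumFields.BalabanUV.Beta.FP.TowerHN2RowMixedWard (hJΛ2'_of_wardRow)
open Summit.QuantumFields.BalabanUV.Beta.FP.TowerHLinkRows (hb_top hb_linear cf_summable hlink_row)
open Summit.QuantumFields.BalabanUV.Beta.FP.TowerHLinkRowsLower (kappa_row kappa_top w_top)  open Summit.QuantumFields.BalabanUV.Beta.FP.TowerK1RowTopColumn (K1_row_top)
open Summit.QuantumFields.BalabanUV.Beta.FP.TorusCompositeNestedJetsSym (nestedRowsSym_eq_compRowsSym nestedQ₁Sym_eq_smul_compIns₁Sym nestedQ₂Sym_symm_eq_smul_compIns₂₂Sym)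
open Summit.QuantumFields.BalabanUV.Beta.FP.TorusCompositeCovariance (itRoot)  open Summit.QuantumFields.BalabanUV.Beta.CompositeVertexKernelRec (compLinKer)
open Summit.QuantumFields.BalabanUV.Beta.AxialDressingRooted (one_le_of_neZero)  open Summit.QuantumFields.BalabanUV.Beta.CompositeOneShotJets (tabsComp)
open Summit.QuantumFields.BalabanUV.Beta.FP.TorusGaugeCovariancePairing (wrapPt)  open Summit.QuantumFields.BalabanUV.Beta.NVertexLamCorePeriodised (towerTorus_fine_apply_eq)
open Summit.QuantumFields.BalabanUV.Beta.NVertexLamFold (sum_perF_AN_mul_periodised_cf_eq_tower)  open Summit.QuantumFields.BalabanUV.Beta.FP.TowerLamSourceDisplay (hΛS_of_road_data)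
open Summit.QuantumFields.BalabanUV.Beta.CombWilsonT2EvenPairRow (torus_T2evenPair_pureGauge_snd_fun)  open WilsonVertex2Sym (wsym22)
open Summit.QuantumFields.BalabanUV.Beta.FP.TorusWJunctionOfNLeg (hv_single_apply_eq_of_NLeg_sym)  open Summit.QuantumFields.BalabanUV.Beta.FP.TorusCompositeObjects (bigRoot bigRatio towerEquiv)  open Summit.QuantumFields.BalabanUV.Beta.FP.TorusCompositeUnimodular (towerEvalC)
open BalabanStepJets (lamCoeffOf)  open OneStepResolventKernel (KInv)  open WilsonBiStencil (wilsonW₂)  open BalabanStepW2 (M2Of)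

variable {Lc : ℕ} [NeZero Lc]
set_option maxHeartbeats 400000 in
set_option synthInstance.maxSize 1024 in
/-- [folklore] **THE END WRAPPER v7: v6's `D1Tel` AT THE RECORD PAIR WITH (J-ΛS) AND (J-X₂) DISCHARGED** — v5's four N-rows, H-side storey rows, shape ∕ slot letters and (J-Λ-fold)
discharged by name as in v6; NEW: the source display (J-ΛS) is fed by `TowerLamSourceDisplay.hΛS_of_road_data` at `cΛS := Pn.cΛ (n+2)` and the Wilson Ward row (J-X₂) by an2 PART 27
`CombWilsonT2EvenPairRow.torus_T2evenPair_pureGauge_snd_fun` under the table pin `hTW` (`2 ≤ N`); displayed: the pins `hr hdv hlve hXbf hfN hcfe hhbe hκe hwe hH₂f hTW`, the tables `hT₂ hM₂` +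
column family `hm hml hJM`, the scalar locks `hcVH hcΛ hcB hcE₂ hcM₂ hLk`, the rows (K2b) `hK2b` (+ `Rs`) and (J-R₂) `hR₂`; the read-out `lv` PINNED (`hlve`, g39's explicit form) so that
its linearity and (J-W″) `hJW` are theorems of the (S3-1) N system (`TorusWJunctionOfNLeg.hv_single_apply_eq_of_NLeg_sym`); v5's law feed VERBATIM. -/
theorem d1Tel_JcComp_ctr_namedF (hLc : Odd Lc) (N : ℕ) [NeZero N] (hN : 2 ≤ N) (cΛ cB : ℝ) (Pn : Pins)
    -- the coarse box sequence (any growing one) and END-Comp's F ∕ G systems, storey-indexed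
    (Mc : ℕ → (Fin (3 + 1) → ℕ)) [∀ B μ, NeZero (Mc B μ)] (hMc : ∀ K : ℕ, ∀ᶠ B in atTop, ∀ i, K ≤ Mc B i)
    (AF : ℕ → MKer (3 + 1) (Fib 3)) (𝒱F : ℕ → Fin (3 + 1) → (Fin (3 + 1) → ℤ) → MKer (3 + 1) (Fib 3))
    (𝒲F : ℕ → Fin (3 + 1) → (Fin (3 + 1) → ℤ) → Fin (3 + 1) → (Fin (3 + 1) → ℤ) → MKer (3 + 1) (Fib 3))
    (𝒱G : ℕ → Fin (3 + 1) → (Fin (3 + 1) → ℤ) → MKer (3 + 1) (Fib 3))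
    (𝒲G : ℕ → Fin (3 + 1) → (Fin (3 + 1) → ℤ) → Fin (3 + 1) → (Fin (3 + 1) → ℤ) → MKer (3 + 1) (Fib 3))
    (𝒲bF 𝒲bG : ℕ → ℕ → Fin (3 + 1) → (Fin (3 + 1) → ℤ) → Fin (3 + 1) → (Fin (3 + 1) → ℤ) → MKer (3 + 1) (Fib 3))
    {H₀ : ∀ n : ℕ, ∀ B : ℕ, Matrix (↥(pbox (towerTorus Lc (fine Lc (Mc B)) (n + 1))) × Fin (3 + 1)) (↥(pbox (towerTorus Lc (fine Lc (Mc B)) (n + 1))) × Fin (3 + 1)) ℝ}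
    {Q₁₀ : ∀ n : ℕ, ∀ B : ℕ, Matrix (↥(pbox (fine Lc (Mc B))) × Fin (3 + 1)) (↥(pbox (towerTorus Lc (fine Lc (Mc B)) (n + 1))) × Fin (3 + 1)) ℝ}
    {τ₁ : ∀ n : ℕ, ∀ B : ℕ, Matrix (NParam Lc (fine Lc (fine Lc (Mc B))) (fun k => (fun _ : ℕ => ctrOff (3 + 1) Lc) (k + 1)) n) (↥(pbox (towerTorus Lc (fine Lc (Mc B)) (n + 1))) × Fin (3 + 1)) ℝ}
    (hH₀ : ∀ n : ℕ, ∀ B : ℕ, ((H₀ n) B) = (perF (towerTorus Lc (fine Lc (Mc B)) (n + 1)) (bhKStepSh 3 Lc (Dsh Lc) ((n + 1 - (n + 1))))).submatrix (fun b : (↥(pbox (towerTorus Lc (fine Lc (Mc B)) (n + 1))) × Fin (3 + 1)) => ((b.1, Sum.inl b.2) : Idx (towerTorus Lc (fine Lc (Mc B)) (n + 1)) (Fib 3))) (fun b : (↥(pbox (towerTorus Lc (fine Lc (Mc B)) (n + 1))) × Fin (3 + 1)) => ((b.1, Sum.inl b.2) : Idx (towerTorus Lc (fine Lc (Mc B))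 (n + 1)) (Fib 3))))
    (hQ₁₀ : ∀ n : ℕ, ∀ B : ℕ, ((Q₁₀ n) B) = compRowsSym Lc (fine Lc (Mc B)) (fun i : ℕ => n + 1 - i) (fun _ : ℕ => ctrOff (3 + 1) Lc) (n + 1))
    (hτ₁ : ∀ n : ℕ, ∀ B : ℕ, ((τ₁ n) B) = bigP Lc (fine Lc (fine Lc (Mc B))) (fun k => (fun _ : ℕ => ctrOff (3 + 1) Lc) (k + 1)) (fun _ => toSite_mem_range (ctrOff_mem_box (d := 3 + 1) (Nat.one_le_iff_ne_zero.mpr (NeZero.ne Lc)))) n)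
    {τ₂ : ∀ n : ℕ, ∀ B : ℕ, Matrix (Res (toSite (ctrOff (3 + 1) Lc)) Lc (fine Lc (Mc B))) (↥(pbox (fine Lc (Mc B))) × Fin (3 + 1)) ℝ}
    (hτ₂ : ∀ n : ℕ, ∀ B : ℕ, ((τ₂ n) B) = combF Lc (fine Lc (Mc B)) ((fun _ : ℕ => ctrOff (3 + 1) Lc) 0))
    -- the top step's (0.4)-symmetrised averaging rows (level `lev 0`), PINNED in (B)'s slot presentation; its comb-KKT `htop` discharged inside
    {Q₂₀ : ∀ n : ℕ, ∀ B : ℕ, Matrix ((↥(pbox (Mc B)) × Fin (3 + 1))) (↥(pbox (fine Lc (Mc B))) × Fin (3 + 1)) ℝ}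
    (hQ₂₀ : ∀ n : ℕ, ∀ B : ℕ, ((Q₂₀ n) B) = (perF (fine Lc (Mc B)) (bhKStepSh 3 Lc (Dsh Lc) ((n + 1 - 0)))).submatrix (fun a : ((↥(pbox (Mc B)) × Fin (3 + 1))) => ((coarsePt (Mc B) Lc a.1, Sum.inr (a.2)) : Idx (fine Lc (Mc B)) (Fib 3))) (fun b : ↥(pbox (fine Lc (Mc B))) × Fin (3 + 1) => ((b.1, Sum.inl b.2) : Idx (fine Lc (Mc B)) (Fib 3))))
    {W₀ : ∀ n : ℕ, ∀ B : ℕ, Matrix (↥(pbox (towerTorus Lc (fine Lc (Mc B)) (n + 1))) × Fin (3 + 1)) (NParam Lc (fine Lc (Mc B)) (fun _ : ℕ => ctrOff (3 + 1) Lc) (n + 1)) ℝ}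
    (hW₀ : ∀ n : ℕ, ∀ B : ℕ, ((W₀ n) B) = towerGen Lc (fine Lc (Mc B)) (fun _ : ℕ => ctrOff (3 + 1) Lc) (n + 1))
    {P : ∀ n : ℕ, ∀ B : ℕ, Matrix (NParam Lc (fine Lc (Mc B)) (fun _ : ℕ => ctrOff (3 + 1) Lc) (n + 1)) (↥(pbox (towerTorus Lc (fine Lc (Mc B)) (n + 1))) × Fin (3 + 1)) ℝ}
    (hP : ∀ n : ℕ, ∀ B : ℕ, ((P n) B) = bigP Lc (fine Lc (Mc B)) (fun _ : ℕ => ctrOff (3 + 1) Lc) (fun _ => toSite_mem_range (ctrOff_mem_box (d := 3 + 1) (Nat.one_le_iff_ne_zero.mpr (NeZero.ne Lc)))) (n + 1))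
    -- the step constant of the chart transport (#21's `c`), the (COV-m) order-0 image PINNED, the one-shot resolvent words and `𝔔₀` NAMED (#21 VERBATIM)
    (c : ∀ n : ℕ, ℝ)
    -- v7: THE PINS `r n` OF THE DIRECTIONS, THE SCALAR LOCK ROWS on the free pins (R-D1-g66-1 `hcVH`, R-FP-81 `hcΛ`, SPEC-54 §5 `hcB`, g45 `hcE₂`, PART 3a `hcM₂`, PART 3b `hLk` at `cΛS := Pn.cΛ (n+2)`) and THE WILSON TABLE PIN `hTW` (an2 PART 27's symmetric-block table; replaces v6's (J-X₂) row)
    (r : ∀ n : ℕ, ℝ) (hr : ∀ n : ℕ, (-2 * (c n)) * (r n) = Pn.cE (n + 1 + 1))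
    (hcVH : ∀ n : ℕ, 2 * Pn.cVH (n + 1 + 1) = -((∏ ℓ ∈ range (n + 1 + 1), (stepScale 3 Lc ℓ * (Lc : ℝ) ^ (3 + 1))) * Pn.cE (n + 1 + 1)))
    (hcΛ : ∀ n : ℕ, 2 * Pn.cΛ (n + 1 + 1) = ((Lc : ℝ) ^ (3 + 1)) ^ (n + 1 + 1) * Pn.cE (n + 1 + 1))
    (hcB : ∀ n : ℕ, (c n) ^ 2 * (r n) * (r n) * ∏ ℓ ∈ range (n + 1 + 1), (stepScale 3 Lc ℓ * ((box (3 + 1) Lc).card : ℝ)) = -(Pn.cB (n + 1 + 1)))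
    (hcE₂ : ∀ n : ℕ, (Pn.cE (n + 1 + 1)) ^ 2 = Pn.cE₂ (n + 1 + 1))
    (hTW : ∀ n : ℕ, Pn.T (n + 1 + 1) = (8 * (N : ℝ) ^ 2)⁻¹ • wsym22 N)
    (cM₂ κ₂ : ∀ n : ℕ, ℝ) (hcM₂ : ∀ n : ℕ, (cM₂ n) * (r n) * (r n) = 1) (hLk : ∀ n : ℕ, (c n) * Pn.cΛ (n + 1 + 1) = (cM₂ n) * (r n) * (κ₂ n))
    {Dbar : ∀ n : ℕ, ∀ B : ℕ, Matrix (↥(pbox (fine Lc (Mc B))) × Fin (3 + 1)) (Res (toSite (ctrOff (3 + 1) Lc)) Lc (fine Lc (Mc B))) ℝ}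
    (hDbar : ∀ n : ℕ, ∀ B : ℕ, ((Dbar n) B) = (∏ i ∈ range (n + 1), (stepScale 3 Lc ((n + 1 - (i + 1))) * ((box (3 + 1) Lc).card : ℝ))) • (tgrad (fine Lc (Mc B))).submatrix (fun a : (↥(pbox (fine Lc (Mc B))) × Fin (3 + 1)) => ((a.1, Sum.inl a.2) : Idx (fine Lc (Mc B)) (Fib 3))) (fun t : (Res (toSite (ctrOff (3 + 1) Lc)) Lc (fine Lc (Mc B))) => (t.1 : ↥(pbox (fine Lc (Mc B))))))
    {Γ : ∀ n : ℕ, ∀ B : ℕ, Matrix (↥(pbox (towerTorus Lc (fine Lc (Mc B)) (n + 1))) × Fin (3 + 1)) (↥(pbox (towerTorus Lc (fine Lc (Mc B)) (n + 1))) × Fin (3 + 1)) ℝ}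
    {I : ∀ n : ℕ, ∀ B : ℕ, Matrix (↥(pbox (towerTorus Lc (fine Lc (Mc B)) (n + 1))) × Fin (3 + 1)) ((↥(pbox (fine Lc (Mc B))) × Fin (3 + 1)) ⊕ (NParam Lc (fine Lc (fine Lc (Mc B))) (fun k => (fun _ : ℕ => ctrOff (3 + 1) Lc) (k + 1)) n)) ℝ}
    {L : ∀ n : ℕ, ∀ B : ℕ, Matrix ((↥(pbox (fine Lc (Mc B))) × Fin (3 + 1)) ⊕ (NParam Lc (fine Lc (fine Lc (Mc B))) (fun k => (fun _ : ℕ => ctrOff (3 + 1) Lc) (k + 1)) n)) (↥(pbox (towerTorus Lc (fine Lc (Mc B)) (n + 1))) × Fin (3 + 1)) ℝ}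
    {S : ∀ n : ℕ, ∀ B : ℕ, Matrix ((↥(pbox (fine Lc (Mc B))) × Fin (3 + 1)) ⊕ (NParam Lc (fine Lc (fine Lc (Mc B))) (fun k => (fun _ : ℕ => ctrOff (3 + 1) Lc) (k + 1)) n)) ((↥(pbox (fine Lc (Mc B))) × Fin (3 + 1)) ⊕ (NParam Lc (fine Lc (fine Lc (Mc B))) (fun k => (fun _ : ℕ => ctrOff (3 + 1) Lc) (k + 1)) n)) ℝ}
    (hΓ : ∀ n : ℕ, ∀ B : ℕ, flucCov ((H₀ n) B) (fromRows ((Q₁₀ n) B) ((τ₁ n) B)) = ((Γ n) B))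
    (hI : ∀ n : ℕ, ∀ B : ℕ, minOp ((H₀ n) B) (fromRows ((Q₁₀ n) B) ((τ₁ n) B)) = ((I n) B))
    (hL : ∀ n : ℕ, ∀ B : ℕ, minOpL ((H₀ n) B) (fromRows ((Q₁₀ n) B) ((τ₁ n) B)) = ((L n) B))
    (hS : ∀ n : ℕ, ∀ B : ℕ, effForm ((H₀ n) B) (fromRows ((Q₁₀ n) B) ((τ₁ n) B)) = ((S n) B))
    {𝔔₀ : ∀ n : ℕ, ∀ B : ℕ, Matrix ((↥(pbox (Mc B)) × Fin (3 + 1))) (↥(pbox (towerTorus Lc (fine Lc (Mc B)) (n + 1))) × Fin (3 + 1)) ℝ}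
    (h𝔔₀ : ∀ n : ℕ, ∀ B : ℕ, ((Q₂₀ n) B) * ((Q₁₀ n) B) = ((𝔔₀ n) B))
    -- the direction module FIXED (R-FP-72, SPEC-45 v1.6 §A row 6): directions = TOP one-shot SOURCE weights `v : κ B → ℝ`; finest-level direction `hv B v` PINNED to the NESTED COMPOSITE COLUMN `I · (minOp S₁₁ [Q₂₀; τ₂] · (v, 0), 0)` (leaf-06 G-5's `h`); tree-gauge ∕ top-generator read-outs `lv Xbf` DISPLAYED (linear; enter the one-shot namings only) — v7.1: `lv` PINNED (`hlve`) to g39 `TorusWJunctionOfNLeg.hv_single_apply_eq_of_NLeg_sym`'s explicit read-out (minus the one-shot big-comb integral of the nested column's tower modes); its linearity and the letter (J-W″) `hJW` are THEOREMS inside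
    {hv : ∀ n : ℕ, ∀ B : ℕ, ((↥(pbox (Mc B)) × Fin (3 + 1)) → ℝ) → ((↥(pbox (towerTorus Lc (fine Lc (Mc B)) (n + 1))) × Fin (3 + 1)) → ℝ)}
    (hhv : ∀ n : ℕ, ∀ B : ℕ, ∀ v, ((hv n) B) v = ((I n) B) *ᵥ Sum.elim (minOp ((S n) B).toBlocks₁₁ (fromRows ((Q₂₀ n) B) ((τ₂ n) B)) *ᵥ Sum.elim v 0) 0)
    (lv : ∀ n : ℕ, ∀ B : ℕ, ((↥(pbox (Mc B)) × Fin (3 + 1)) → ℝ) → (↥(pbox (towerTorus Lc (fine Lc (Mc B)) (n + 1))) → ℝ))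
    (hlve : ∀ n : ℕ, ∀ B : ℕ, ∀ (v : ((↥(pbox (Mc B)) × Fin (3 + 1)) → ℝ)) (s : ↥(pbox (towerTorus Lc (fine Lc (Mc B)) (n + 1)))), ((lv n) B) v s = -(∑ x : Res (bigRoot Lc (fun _ : ℕ => ctrOff (3 + 1) Lc) (n + 1)) (bigRatio Lc (n + 1)) (towerTorus Lc (fine Lc (Mc B)) (n + 1)), (if (x.1 : ↥(pbox (towerTorus Lc (fine Lc (Mc B)) (n + 1)))) = s then (towerEvalC Lc (fine Lc (Mc B)) (fun _ : ℕ => ctrOff (3 + 1) Lc) (fun _ => toSite_mem_range (ctrOff_mem_box (d := 3 + 1) (Nat.one_le_iff_ne_zero.mpr (NeZero.ne Lc)))) (n + 1) *ᵥ ((((P n) B) * ((W₀ n) B))⁻¹ *ᵥ (((P n) B) *ᵥ ((hv n) B) v))) (towerEquiv Lc (fine Lc (Mc B)) (fun _ : ℕ => ctrOff (3 + 1) Lc) (fun _ => toSite_mem_range (ctrOff_mem_box (d := 3 + 1) (Nat.one_le_iff_ne_zero.mpr (NeZero.ne Lc)))) (n + 1) x) else 0)))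
    (Xbf : ∀ n : ℕ, ∀ B : ℕ, ((↥(pbox (Mc B)) × Fin (3 + 1)) → ℝ) → Matrix ((↥(pbox (Mc B)) × Fin (3 + 1))) ((↥(pbox (Mc B)) × Fin (3 + 1))) ℝ)
    (hXbf : ∀ n : ℕ, ∀ B : ℕ, ∀ v, ((Xbf n) B) v = (c n) • Matrix.diagonal (fun a : (↥(pbox (Mc B)) × Fin (3 + 1)) => ((lv n) B) v (itRoot Lc (Mc B) (fun _ : ℕ => ctrOff (3 + 1) Lc) (fun _ => (ctrOff_mem_box (d := 3 + 1) (Nat.one_le_iff_ne_zero.mpr (NeZero.ne Lc)))) (n + 1 + 1) a.1)))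
    -- #21's displayed jets AS FUNCTIONS of the direction: first order linear, second order in two slots (linear in each; the door reads the diagonal)
    (H₁f : ∀ n : ℕ, ∀ B : ℕ, ((↥(pbox (Mc B)) × Fin (3 + 1)) → ℝ) → Matrix (↥(pbox (towerTorus Lc (fine Lc (Mc B)) (n + 1))) × Fin (3 + 1)) (↥(pbox (towerTorus Lc (fine Lc (Mc B)) (n + 1))) × Fin (3 + 1)) ℝ)
    {Q₁₁f : ∀ n : ℕ, ∀ B : ℕ, ((↥(pbox (Mc B)) × Fin (3 + 1)) → ℝ) → Matrix (↥(pbox (fine Lc (Mc B))) × Fin (3 + 1)) (↥(pbox (towerTorus Lc (fine Lc (Mc B)) (n + 1))) × Fin (3 + 1)) ℝ}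
    (hQ₁₁f : ∀ n : ℕ, ∀ B : ℕ, ∀ v, ((Q₁₁f n) B) v = (c n) • compIns₁Sym Lc (fine Lc (Mc B)) (fun i : ℕ => n + 1 - i) (fun _ : ℕ => ctrOff (3 + 1) Lc) (n + 1) (((hv n) B) v))
    {Q₂₁f : ∀ n : ℕ, ∀ B : ℕ, ((↥(pbox (Mc B)) × Fin (3 + 1)) → ℝ) → Matrix ((↥(pbox (Mc B)) × Fin (3 + 1))) (↥(pbox (fine Lc (Mc B))) × Fin (3 + 1)) ℝ}
    (hQ₂₁f : ∀ n : ℕ, ∀ B : ℕ, ∀ v, ((Q₂₁f n) B) v = ∑ a' : (↥(pbox (fine Lc (Mc B))) × Fin (3 + 1)), (((c n) * (((Lc : ℝ) ^ (3 + 1) * stepScale 3 Lc ((n + 1 - 0))) * (∏ i ∈ range (n + 1), (stepScale 3 Lc ((n + 1 - (i + 1))) * ((box (3 + 1) Lc).card : ℝ)))⁻¹)) * (compRowsSym Lc (fine Lc (Mc B)) (fun i : ℕ => n + 1 - i) (fun _ : ℕ => ctrOff (3 + 1) Lc) (n + 1) *ᵥ (((hv n) B) v)) a') • (perF (fine Lc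 (Mc B)) (dper (fine Lc (Mc B)) (symVhSAt (ctr (3 + 1) Lc) 3 Lc rfl a'.2 (a'.1 : Site (3 + 1))))).submatrix (fun k : (↥(pbox (Mc B)) × Fin (3 + 1)) => (((coarsePt (Mc B) Lc k.1, Sum.inr (k.2)) : Idx (fine Lc (Mc B)) (Fib 3)))) (fun b : (↥(pbox (fine Lc (Mc B))) × Fin (3 + 1)) => ((b.1, Sum.inl b.2) : Idx (fine Lc (Mc B)) (Fib 3))))
    (H₂f : ∀ n : ℕ, ∀ B : ℕ, ((↥(pbox (Mc B)) × Fin (3 + 1)) → ℝ) → ((↥(pbox (Mc B)) × Fin (3 + 1)) → ℝ) → Matrix (↥(pbox (towerTorus Lc (fine Lc (Mc B)) (n + 1))) × Fin (3 + 1)) (↥(pbox (towerTorus Lc (fine Lc (Mc B)) (n + 1))) × Fin (3 + 1)) ℝ)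
    -- v7: THE SECOND H-JET PINNED (`FP/TowerH2Letters`): Wilson bi-sector over the table `T̂₂` (letter `hT₂`; its Ward row (J-X₂) is DISCHARGED inside by an2 PART 27 under the table pin `hTW`) + mixed sector
    -- over the multiplier-column family `hm` (letter `hJM`) and the wound even mixed table `ℳ̂₂` (letter `hM₂`); PART 3b's rows (K2b) `hK2b` (site-remainder family `Rs` DISPLAYED) and (J-R₂) `hR₂` ((J-ΛS) is DISCHARGED inside, `cΛS := Pn.cΛ (n+2)`)
    (T₂ : ∀ n : ℕ, ∀ B : ℕ, (↥(pbox (towerTorus Lc (fine Lc (Mc B)) (n + 1))) × Fin (3 + 1)) → (↥(pbox (towerTorus Lc (fine Lc (Mc B)) (n + 1))) × Fin (3 + 1)) → Matrix (↥(pbox (towerTorus Lc (fine Lc (Mc B)) (n + 1))) × Fin (3 + 1)) (↥(pbox (towerTorus Lc (fine Lc (Mc B)) (n + 1))) × Fin (3 + 1)) ℝ)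
    (hT₂ : ∀ n : ℕ, ∀ B : ℕ, ∀ b b' : ↥(pbox (towerTorus Lc (fine Lc (Mc B)) (n + 1))) × Fin (3 + 1), ((T₂ n) B) b b' = (1 / 2 : ℝ) • ((perF (towerTorus Lc (fine Lc (Mc B)) (n + 1)) (dper (towerTorus Lc (fine Lc (Mc B)) (n + 1)) (fun X Z i₁ i₂ => ∑' m : Site (3 + 1), ((1 / 2 : ℝ) • (wilsonW₂ 3 (Pn.T (n + 1 + 1)) b.2 (b.1 : Site (3 + 1)) b'.2 (translate (towerTorus Lc (fine Lc (Mc B)) (n + 1)) (b'.1 : Site (3 + 1)) m) + sgnK (trK (wilsonW₂ 3 (Pn.T (n + 1 + 1)) b.2 (b.1 : Site (3 + 1)) b'.2 (translate (towerTorus Lc (fine Lc (Mc B)) (n + 1)) (b'.1 : Site (3 + 1)) m))))) X Z i₁ i₂))).submatrix (fun b : ↥(pbox (towerTorus Lc (fine Lc (Mc B)) (n + 1))) × Fin (3 + 1) => ((b.1, Sum.inl b.2) : Idx (towerTorus Lc (fine Lc (Mc B)) (n + 1)) (Fib 3))) (fun b : ↥(pbox (towerTorus Lc (fine Lc (Mc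 B)) (n + 1))) × Fin (3 + 1) => ((b.1, Sum.inl b.2) : Idx (towerTorus Lc (fine Lc (Mc B)) (n + 1)) (Fib 3))) + (perF (towerTorus Lc (fine Lc (Mc B)) (n + 1)) (dper (towerTorus Lc (fine Lc (Mc B)) (n + 1)) (fun X Z i₁ i₂ => ∑' m : Site (3 + 1), ((1 / 2 : ℝ) • (wilsonW₂ 3 (Pn.T (n + 1 + 1)) b'.2 (b'.1 : Site (3 + 1)) b.2 (translate (towerTorus Lc (fine Lc (Mc B)) (n + 1)) (b.1 : Site (3 + 1)) m) + sgnK (trK (wilsonW₂ 3 (Pn.T (n + 1 + 1)) b'.2 (b'.1 : Site (3 + 1)) b.2 (translate (towerTorus Lc (fine Lc (Mc B)) (n + 1)) (b.1 : Site (3 + 1)) m))))) X Z i₁ i₂))).submatrix (fun b : ↥(pbox (towerTorus Lc (fine Lc (Mc B)) (n + 1))) × Fin (3 + 1) => ((b.1, Sum.inl b.2) : Idx (towerTorus Lc (fine Lc (Mc B)) (n + 1)) (Fib 3))) (fun b : ↥(pbox (towerTorus Lc (fine Lc (Mc B)) (n + 1))) × Fin (3 + 1) => ((b.1, Sum.inl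 b.2) : Idx (towerTorus Lc (fine Lc (Mc B)) (n + 1)) (Fib 3)))))
    (hm : ∀ n : ℕ, ∀ B : ℕ, ((↥(pbox (Mc B)) × Fin (3 + 1)) → ℝ) → (↥(pbox (Mc B)) × Fin (3 + 1) → ℝ))
    (hml : ∀ n : ℕ, ∀ B : ℕ, ∀ (r : ℝ) (x y : ((↥(pbox (Mc B)) × Fin (3 + 1)) → ℝ)), ((hm n) B) (r • x + y) = r • ((hm n) B) x + ((hm n) B) y)
    (hJM : ∀ n : ℕ, ∀ B : ℕ, ∀ (a : ↥(pbox (Mc B)) × Fin (3 + 1)) (β : ↥(pbox (Mc B)) × Fin (3 + 1)), ((hm n) B) (Pi.single a 1) β = perF (towerTorus Lc (fine Lc (Mc B)) (n + 1)) (AN (Roots.ctr Lc) (n + 1)) (wrapPt (towerTorus Lc (fine Lc (Mc B)) (n + 1)) (((Lc ^ (n + 1 + 1) : ℕ) : ℤ) • (β.1 : Site (3 + 1))), Sum.inr β.2) (wrapPt (towerTorus Lc (fine Lc (Mc B)) (n + 1)) (((Lc ^ (n + 1 + 1) : ℕ) : ℤ) • (a.1 : Site (3 + 1))), Sum.inr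 a.2))
    (M₂ : ∀ n : ℕ, ∀ B : ℕ, (↥(pbox (towerTorus Lc (fine Lc (Mc B)) (n + 1))) × Fin (3 + 1)) → (↥(pbox (Mc B)) × Fin (3 + 1)) → Matrix (↥(pbox (towerTorus Lc (fine Lc (Mc B)) (n + 1))) × Fin (3 + 1)) (↥(pbox (towerTorus Lc (fine Lc (Mc B)) (n + 1))) × Fin (3 + 1)) ℝ)
    (hM₂ : ∀ n : ℕ, ∀ B : ℕ, ∀ (b : ↥(pbox (towerTorus Lc (fine Lc (Mc B)) (n + 1))) × Fin (3 + 1)) (β : ↥(pbox (Mc B)) × Fin (3 + 1)), ((M₂ n) B) b β = (perF (towerTorus Lc (fine Lc (Mc B)) (n + 1)) (dper (towerTorus Lc (fine Lc (Mc B)) (n + 1)) (fun X Z i₁ i₂ => ∑' m : Site (3 + 1), ((1 / 2 : ℝ) • (M2Of 3 (Lc ^ (n + 1 + 1)) (tabsComp (n + 1 + 1) (one_le_of_neZero Lc) (Roots.ctr Lc).hr (Pn.cM (n + 1 + 1))).mixFF 0 b.2 (b.1 : Site (3 + 1)) β.2 (translate (Mc B) (β.1 : Site (3 + 1)) m) +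 sgnK (trK (M2Of 3 (Lc ^ (n + 1 + 1)) (tabsComp (n + 1 + 1) (one_le_of_neZero Lc) (Roots.ctr Lc).hr (Pn.cM (n + 1 + 1))).mixFF 0 b.2 (b.1 : Site (3 + 1)) β.2 (translate (Mc B) (β.1 : Site (3 + 1)) m))))) X Z i₁ i₂))).submatrix (fun b : ↥(pbox (towerTorus Lc (fine Lc (Mc B)) (n + 1))) × Fin (3 + 1) => ((b.1, Sum.inl b.2) : Idx (towerTorus Lc (fine Lc (Mc B)) (n + 1)) (Fib 3))) (fun b : ↥(pbox (towerTorus Lc (fine Lc (Mc B)) (n + 1))) × Fin (3 + 1) => ((b.1, Sum.inl b.2) : Idx (towerTorus Lc (fine Lc (Mc B)) (n + 1)) (Fib 3))))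
    (hH₂f : ∀ n : ℕ, ∀ B : ℕ, ∀ v v', ((H₂f n) B) v v' = (-2 * (c n)) ^ 2 • ∑ b : ↥(pbox (towerTorus Lc (fine Lc (Mc B)) (n + 1))) × Fin (3 + 1), ∑ b' : ↥(pbox (towerTorus Lc (fine Lc (Mc B)) (n + 1))) × Fin (3 + 1), (((hv n) B) v b * ((hv n) B) v' b') • ((T₂ n) B) b b' + (cM₂ n) • ∑ b : ↥(pbox (towerTorus Lc (fine Lc (Mc B)) (n + 1))) × Fin (3 + 1), ∑ β : ↥(pbox (Mc B)) × Fin (3 + 1), (((hv n) B) v b * ((hm n) B) v' β + ((hv n) B) v' b * ((hm n) B) v β) • ((M₂ n) B) b β)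
    (Rs : ∀ n : ℕ, ∀ B : ℕ, ↥(pbox (towerTorus Lc (fine Lc (Mc B)) (n + 1))) → (↥(pbox (Mc B)) × Fin (3 + 1)) → Matrix (↥(pbox (towerTorus Lc (fine Lc (Mc B)) (n + 1))) × Fin (3 + 1)) (↥(pbox (towerTorus Lc (fine Lc (Mc B)) (n + 1))) × Fin (3 + 1)) ℝ)
    (hK2b : ∀ n : ℕ, ∀ B : ℕ, ∀ (lam : ↥(pbox (towerTorus Lc (fine Lc (Mc B)) (n + 1))) → ℝ) (β : ↥(pbox (Mc B)) × Fin (3 + 1)), ∑ b : ↥(pbox (towerTorus Lc (fine Lc (Mc B)) (n + 1))) × Fin (3 + 1), (∑ s : ↥(pbox (towerTorus Lc (fine Lc (Mc B)) (n + 1))), tgrad (towerTorus Lc (fine Lc (Mc B)) (n + 1)) (b.1, Sum.inl b.2) s * lam s) • ((M₂ n) B) b β = (κ₂ n) • (Matrix.diagonal (fun b : ↥(pbox (towerTorus Lc (fine Lc (Mc B)) (n + 1))) × Fin (3 + 1) => lam b.1) * (perF (towerTorus Lc (fine Lc (Mc B)) (n + 1)) (dper (towerTorus Lc (fine Lc (Mc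 B)) (n + 1)) ((tabsComp (n + 1 + 1) (one_le_of_neZero Lc) (Roots.ctr Lc).hr (Pn.cM (n + 1 + 1))).H β.2 (β.1 : Site (3 + 1))))).submatrix (fun b : ↥(pbox (towerTorus Lc (fine Lc (Mc B)) (n + 1))) × Fin (3 + 1) => ((b.1, Sum.inl b.2) : Idx (towerTorus Lc (fine Lc (Mc B)) (n + 1)) (Fib 3))) (fun b : ↥(pbox (towerTorus Lc (fine Lc (Mc B)) (n + 1))) × Fin (3 + 1) => ((b.1, Sum.inl b.2) : Idx (towerTorus Lc (fine Lc (Mc B)) (n + 1)) (Fib 3))) - (perF (towerTorus Lc (fine Lc (Mc B)) (n + 1)) (dper (towerTorus Lc (fine Lc (Mc B)) (n + 1)) ((tabsComp (n + 1 + 1) (one_le_of_neZero Lc) (Roots.ctr Lc).hr (Pn.cM (n + 1 + 1))).H β.2 (β.1 : Site (3 + 1))))).submatrix (fun b : ↥(pbox (towerTorus Lc (fine Lc (Mc B)) (n + 1))) × Fin (3 + 1) => ((b.1, Sum.inl b.2) : Idx (towerTorus Lc (fine Lc (Mc B)) (n + 1)) (Fib 3))) (fun b : ↥(pbox (towerTorus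 Lc (fine Lc (Mc B)) (n + 1))) × Fin (3 + 1) => ((b.1, Sum.inl b.2) : Idx (towerTorus Lc (fine Lc (Mc B)) (n + 1)) (Fib 3))) * Matrix.diagonal (fun b : ↥(pbox (towerTorus Lc (fine Lc (Mc B)) (n + 1))) × Fin (3 + 1) => lam b.1)) + ∑ s : ↥(pbox (towerTorus Lc (fine Lc (Mc B)) (n + 1))), lam s • ((Rs n) B) s β)
    {Q₁₂f : ∀ n : ℕ, ∀ B : ℕ, ((↥(pbox (Mc B)) × Fin (3 + 1)) → ℝ) → ((↥(pbox (Mc B)) × Fin (3 + 1)) → ℝ) → Matrix (↥(pbox (fine Lc (Mc B))) × Fin (3 + 1)) (↥(pbox (towerTorus Lc (fine Lc (Mc B)) (n + 1))) × Fin (3 + 1)) ℝ}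
    (hQ₁₂f : ∀ n : ℕ, ∀ B : ℕ, ∀ v v', ((Q₁₂f n) B) v v' = (c n) ^ 2 • compIns₂₂Sym Lc (fine Lc (Mc B)) (fun i : ℕ => n + 1 - i) (fun _ : ℕ => ctrOff (3 + 1) Lc) (n + 1) (((hv n) B) v) (((hv n) B) v'))
    {Q₂₂f : ∀ n : ℕ, ∀ B : ℕ, ((↥(pbox (Mc B)) × Fin (3 + 1)) → ℝ) → ((↥(pbox (Mc B)) × Fin (3 + 1)) → ℝ) → Matrix ((↥(pbox (Mc B)) × Fin (3 + 1))) (↥(pbox (fine Lc (Mc B))) × Fin (3 + 1)) ℝ}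
    (hQ₂₂f : ∀ n : ℕ, ∀ B : ℕ, ∀ v v', ((Q₂₂f n) B) v v' = ((Lc : ℝ) ^ (3 + 1) * stepScale 3 Lc ((n + 1 - 0)))⁻¹ • ∑ b : (↥(pbox (fine Lc (Mc B))) × Fin (3 + 1)), ∑ b' : (↥(pbox (fine Lc (Mc B))) × Fin (3 + 1)), ((((c n) * (((Lc : ℝ) ^ (3 + 1) * stepScale 3 Lc ((n + 1 - 0))) * (∏ i ∈ range (n + 1), (stepScale 3 Lc ((n + 1 - (i + 1))) * ((box (3 + 1) Lc).card : ℝ)))⁻¹)) * (compRowsSym Lc (fine Lc (Mc B)) (fun i : ℕ => n + 1 - i) (fun _ : ℕ => ctrOff (3 + 1) Lc) (n + 1) *ᵥ (((hv n) B) v)) b) * (((c n) * (((Lc : ℝ) ^ (3 + 1) * stepScale 3 Lc ((n + 1 - 0))) * (∏ i ∈ range (n + 1), (stepScale 3 Lc ((n + 1 - (i + 1))) * ((box (3 + 1) Lc).card : ℝ)))⁻¹)) * (compRowsSym Lc (fine Lc (Mc B)) (fun i : ℕ => n + 1 - i) (fun _ : ℕ => ctrOff (3 + 1) Lc) (n +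 1) *ᵥ (((hv n) B) v')) b')) • (perF (fine Lc (Mc B)) (dper (fine Lc (Mc B)) (fun x z a e => ∑' m : Site (3 + 1), (1 / 2 : ℝ) * (symVh₂SAt (ctr (3 + 1) Lc) Lc b.2 (b.1 : Site (3 + 1)) b'.2 (translate (fine Lc (Mc B)) (b'.1 : Site (3 + 1)) m) x z a e + symVh₂SAt (ctr (3 + 1) Lc) Lc b'.2 (translate (fine Lc (Mc B)) (b'.1 : Site (3 + 1)) m) b.2 (b.1 : Site (3 + 1)) x z a e)))).submatrix (fun k : (↥(pbox (Mc B)) × Fin (3 + 1)) => (((coarsePt (Mc B) Lc k.1, Sum.inr (k.2)) : Idx (fine Lc (Mc B)) (Fib 3)))) (fun b : (↥(pbox (fine Lc (Mc B))) × Fin (3 + 1)) => ((b.1, Sum.inl b.2) : Idx (fine Lc (Mc B)) (Fib 3))))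
    -- #21's composite and one-shot NAMINGS as functions (`h𝔔₁ h𝔔₂ k1 k2 q1 q2`; `X := −(c • diagonal (λ ∘ pr))` at `λ := lv v`; order 2 in two slots)
    (𝔔₁f : ∀ n : ℕ, ∀ B : ℕ, ((↥(pbox (Mc B)) × Fin (3 + 1)) → ℝ) → Matrix ((↥(pbox (Mc B)) × Fin (3 + 1))) (↥(pbox (towerTorus Lc (fine Lc (Mc B)) (n + 1))) × Fin (3 + 1)) ℝ)
    (h𝔔₁ : ∀ n : ℕ, ∀ B : ℕ, ∀ v, ((Q₂₁f n) B) v * ((Q₁₀ n) B) + ((Q₂₀ n) B) * ((Q₁₁f n) B) v = ((𝔔₁f n) B) v)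
    (𝔔₂f : ∀ n : ℕ, ∀ B : ℕ, ((↥(pbox (Mc B)) × Fin (3 + 1)) → ℝ) → ((↥(pbox (Mc B)) × Fin (3 + 1)) → ℝ) → Matrix ((↥(pbox (Mc B)) × Fin (3 + 1))) (↥(pbox (towerTorus Lc (fine Lc (Mc B)) (n + 1))) × Fin (3 + 1)) ℝ)
    (h𝔔₂ : ∀ n : ℕ, ∀ B : ℕ, ∀ v v', ((Q₂₂f n) B) v v' * ((Q₁₀ n) B) + ((Q₂₁f n) B) v * ((Q₁₁f n) B) v' + (((Q₂₁f n) B) v * ((Q₁₁f n) B) v' + ((Q₂₀ n) B) * ((Q₁₂f n) B) v v') = ((𝔔₂f n) B) v v')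
    (H'₁f : ∀ n : ℕ, ∀ B : ℕ, ((↥(pbox (Mc B)) × Fin (3 + 1)) → ℝ) → Matrix (↥(pbox (towerTorus Lc (fine Lc (Mc B)) (n + 1))) × Fin (3 + 1)) (↥(pbox (towerTorus Lc (fine Lc (Mc B)) (n + 1))) × Fin (3 + 1)) ℝ)
    (hH'₁f : ∀ n : ℕ, ∀ B : ℕ, ∀ v, ((H'₁f n) B) v = -((-((c n) • Matrix.diagonal (fun b : (↥(pbox (towerTorus Lc (fine Lc (Mc B)) (n + 1))) × Fin (3 + 1)) => ((lv n) B) v b.1)))ᵀ * ((H₀ n) B)) + ((H₁f n) B) v + ((H₀ n) B) * (-((c n) • Matrix.diagonal (fun b : (↥(pbox (towerTorus Lc (fine Lc (Mc B)) (n + 1))) × Fin (3 + 1)) => ((lv n) B) v b.1))))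
    (H'₂f : ∀ n : ℕ, ∀ B : ℕ, ((↥(pbox (Mc B)) × Fin (3 + 1)) → ℝ) → ((↥(pbox (Mc B)) × Fin (3 + 1)) → ℝ) → Matrix (↥(pbox (towerTorus Lc (fine Lc (Mc B)) (n + 1))) × Fin (3 + 1)) (↥(pbox (towerTorus Lc (fine Lc (Mc B)) (n + 1))) × Fin (3 + 1)) ℝ)
    (hH'₂f : ∀ n : ℕ, ∀ B : ℕ, ∀ v v', ((H'₂f n) B) v v' = ((-((c n) • Matrix.diagonal (fun b : (↥(pbox (towerTorus Lc (fine Lc (Mc B)) (n + 1))) × Fin (3 + 1)) => ((lv n) B) v b.1))) * (-((c n) • Matrix.diagonal (fun b : (↥(pbox (towerTorus Lc (fine Lc (Mc B)) (n + 1))) × Fin (3 + 1)) => ((lv n) B) v' b.1))))ᵀ * ((H₀ n) B) + (-((-((c n) • Matrix.diagonal (fun b : (↥(pbox (towerTorus Lc (fine Lc (Mc B)) (n + 1))) × Fin (3 + 1)) => ((lv n) B) v b.1)))ᵀ * ((H₁f n) B) v') + -((-((c n) • Matrix.diagonal (fun b : (↥(pbox (towerTorus Lc (fine Lc (Mc B))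 (n + 1))) × Fin (3 + 1)) => ((lv n) B) v b.1)))ᵀ * ((H₀ n) B) * (-((c n) • Matrix.diagonal (fun b : (↥(pbox (towerTorus Lc (fine Lc (Mc B)) (n + 1))) × Fin (3 + 1)) => ((lv n) B) v' b.1))))) + ((-((-((c n) • Matrix.diagonal (fun b : (↥(pbox (towerTorus Lc (fine Lc (Mc B)) (n + 1))) × Fin (3 + 1)) => ((lv n) B) v b.1)))ᵀ * ((H₁f n) B) v') + -((-((c n) • Matrix.diagonal (fun b : (↥(pbox (towerTorus Lc (fine Lc (Mc B)) (n + 1))) × Fin (3 + 1)) => ((lv n) B) v b.1)))ᵀ * ((H₀ n) B) * (-((c n) • Matrix.diagonal (fun b : (↥(pbox (towerTorus Lc (fine Lc (Mc B)) (n + 1))) × Fin (3 + 1)) => ((lv n) B) v' b.1))))) + (((H₂f n) B) v v' + ((H₁f n) B) v * (-((c n) • Matrix.diagonal (fun b : (↥(pbox (towerTorus Lc (fine Lc (Mc B)) (n + 1))) × Fin (3 + 1)) => ((lv n) B) v' b.1))) + (((H₁f n) B) v * (-((c n) • Matrix.diagonal (fun b : (↥(pbox (towerTorus Lc (fine Lc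 (Mc B)) (n + 1))) × Fin (3 + 1)) => ((lv n) B) v' b.1))) + ((H₀ n) B) * ((-((c n) • Matrix.diagonal (fun b : (↥(pbox (towerTorus Lc (fine Lc (Mc B)) (n + 1))) × Fin (3 + 1)) => ((lv n) B) v b.1))) * (-((c n) • Matrix.diagonal (fun b : (↥(pbox (towerTorus Lc (fine Lc (Mc B)) (n + 1))) × Fin (3 + 1)) => ((lv n) B) v' b.1))))))))
    (𝔔'₁f : ∀ n : ℕ, ∀ B : ℕ, ((↥(pbox (Mc B)) × Fin (3 + 1)) → ℝ) → Matrix ((↥(pbox (Mc B)) × Fin (3 + 1))) (↥(pbox (towerTorus Lc (fine Lc (Mc B)) (n + 1))) × Fin (3 + 1)) ℝ)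
    (h𝔔'₁f : ∀ n : ℕ, ∀ B : ℕ, ∀ v, ((𝔔'₁f n) B) v = ((Xbf n) B) v * ((𝔔₀ n) B) + ((𝔔₁f n) B) v + ((𝔔₀ n) B) * (-((c n) • Matrix.diagonal (fun b : (↥(pbox (towerTorus Lc (fine Lc (Mc B)) (n + 1))) × Fin (3 + 1)) => ((lv n) B) v b.1))))
    (𝔔'₂f : ∀ n : ℕ, ∀ B : ℕ, ((↥(pbox (Mc B)) × Fin (3 + 1)) → ℝ) → ((↥(pbox (Mc B)) × Fin (3 + 1)) → ℝ) → Matrix ((↥(pbox (Mc B)) × Fin (3 + 1))) (↥(pbox (towerTorus Lc (fine Lc (Mc B)) (n + 1))) × Fin (3 + 1)) ℝ)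
    (h𝔔'₂f : ∀ n : ℕ, ∀ B : ℕ, ∀ v v', ((𝔔'₂f n) B) v v' = ((Xbf n) B) v * ((Xbf n) B) v' * ((𝔔₀ n) B) + (((Xbf n) B) v * ((𝔔₁f n) B) v' + ((Xbf n) B) v * ((𝔔₀ n) B) * (-((c n) • Matrix.diagonal (fun b : (↥(pbox (towerTorus Lc (fine Lc (Mc B)) (n + 1))) × Fin (3 + 1)) => ((lv n) B) v' b.1)))) + ((((Xbf n) B) v * ((𝔔₁f n) B) v' + ((Xbf n) B) v * ((𝔔₀ n) B) * (-((c n) • Matrix.diagonal (fun b : (↥(pbox (towerTorus Lc (fine Lc (Mc B)) (n + 1))) × Fin (3 + 1)) => ((lv n) B) v' b.1)))) + (((𝔔₂f n) B) v v' + ((𝔔₁f n) B) v * (-((c n) • Matrix.diagonal (fun b : (↥(pbox (towerTorus Lc (fine Lc (Mc B)) (n + 1))) × Fin (3 + 1)) => ((lv n) B) v' b.1))) + (((𝔔₁f n) B) v * (-((c n) • Matrix.diagonal (fun b : (↥(pbox (towerTorus Lc (fine Lc (Mc B)) (n + 1))) × Fin (3 + 1)) => ((lv n) B) v' b.1)))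 + ((𝔔₀ n) B) * ((-((c n) • Matrix.diagonal (fun b : (↥(pbox (towerTorus Lc (fine Lc (Mc B)) (n + 1))) × Fin (3 + 1)) => ((lv n) B) v b.1))) * (-((c n) • Matrix.diagonal (fun b : (↥(pbox (towerTorus Lc (fine Lc (Mc B)) (n + 1))) × Fin (3 + 1)) => ((lv n) B) v' b.1))))))))
    -- #21's generator jets by their closed forms at `h := hv v` (weight `h`), per direction
    (W₁f W₂f : ∀ n : ℕ, ∀ B : ℕ, ((↥(pbox (Mc B)) × Fin (3 + 1)) → ℝ) → Matrix (↥(pbox (towerTorus Lc (fine Lc (Mc B)) (n + 1))) × Fin (3 + 1)) (NParam Lc (fine Lc (Mc B)) (fun _ : ℕ => ctrOff (3 + 1) Lc) (n + 1)) ℝ)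
    (hW₁f : ∀ n : ℕ, ∀ B : ℕ, ∀ v, ((W₁f n) B) v = Matrix.of fun (b : (↥(pbox (towerTorus Lc (fine Lc (Mc B)) (n + 1))) × Fin (3 + 1))) (e : (NParam Lc (fine Lc (Mc B)) (fun _ : ℕ => ctrOff (3 + 1) Lc) (n + 1))) => -((c n) * ((hv n) B) v b * evalN Lc (fine Lc (Mc B)) (fun _ : ℕ => ctrOff (3 + 1) Lc) (n + 1) (fun b' : (↥(pbox (towerTorus Lc (fine Lc (Mc B)) (n + 1))) × Fin (3 + 1)) => (b'.1 : Site (3 + 1)) + unitVec b'.2) b e))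
    (hW₂f : ∀ n : ℕ, ∀ B : ℕ, ∀ v, ((W₂f n) B) v = Matrix.of fun (b : (↥(pbox (towerTorus Lc (fine Lc (Mc B)) (n + 1))) × Fin (3 + 1))) (e : (NParam Lc (fine Lc (Mc B)) (fun _ : ℕ => ctrOff (3 + 1) Lc) (n + 1))) => ((c n) * ((hv n) B) v b) ^ 2 * evalN Lc (fine Lc (Mc B)) (fun _ : ℕ => ctrOff (3 + 1) Lc) (n + 1) (fun b' : (↥(pbox (towerTorus Lc (fine Lc (Mc B)) (n + 1))) × Fin (3 + 1)) => (b'.1 : Site (3 + 1)) + unitVec b'.2) b e)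
    -- the (COV-m) order-1∕2 images PINNED (leaf-02 R-22 ∕ R-27's `D̄₁ D̄₂`: tip-type jets of the transported direction `compRowsSym · hv B v`); the (WARD-m) sources free
    {Db₁f Db₂f : ∀ n : ℕ, ∀ B : ℕ, ((↥(pbox (Mc B)) × Fin (3 + 1)) → ℝ) → Matrix (↥(pbox (fine Lc (Mc B))) × Fin (3 + 1)) (Res (toSite (ctrOff (3 + 1) Lc)) Lc (fine Lc (Mc B))) ℝ}
    (hDb₁f : ∀ n : ℕ, ∀ B : ℕ, ∀ v, ((Db₁f n) B) v = Matrix.of fun (a : (↥(pbox (fine Lc (Mc B))) × Fin (3 + 1))) (t : (Res (toSite (ctrOff (3 + 1) Lc)) Lc (fine Lc (Mc B)))) => -((c n) * (compRowsSym Lc (fine Lc (Mc B)) (fun i : ℕ => n + 1 - i) (fun _ : ℕ => ctrOff (3 + 1) Lc) (n + 1) *ᵥ (((hv n) B) v)) a * tdelta (fine Lc (Mc B)) ((a.1 : Site (3 + 1)) + unitVec a.2) t.1))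
    (hDb₂f : ∀ n : ℕ, ∀ B : ℕ, ∀ v, ((Db₂f n) B) v = Matrix.of fun (a : (↥(pbox (fine Lc (Mc B))) × Fin (3 + 1))) (t : (Res (toSite (ctrOff (3 + 1) Lc)) Lc (fine Lc (Mc B)))) => ((c n) ^ 2 * (∏ i ∈ range (n + 1), (stepScale 3 Lc ((n + 1 - (i + 1))) * ((box (3 + 1) Lc).card : ℝ)))⁻¹) * ((compRowsSym Lc (fine Lc (Mc B)) (fun i : ℕ => n + 1 - i) (fun _ : ℕ => ctrOff (3 + 1) Lc) (n + 1) *ᵥ (((hv n) B) v)) a) ^ 2 * tdelta (fine Lc (Mc B)) ((a.1 : Site (3 + 1)) + unitVec a.2) t.1)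
    (Y₂f : ∀ n : ℕ, ∀ B : ℕ, ((↥(pbox (Mc B)) × Fin (3 + 1)) → ℝ) → Matrix ((↥(pbox (Mc B)) × Fin (3 + 1))) (NParam Lc (fine Lc (Mc B)) (fun _ : ℕ => ctrOff (3 + 1) Lc) (n + 1)) ℝ)
    -- the `G`-side DRESSED WORDS, NAMED (#36b's shapes at `B := [Q₁₁f v; 0]`)
    (Gw₁f : ∀ n : ℕ, ∀ B : ℕ, ((↥(pbox (Mc B)) × Fin (3 + 1)) → ℝ) → Matrix (↥(pbox (fine Lc (Mc B))) × Fin (3 + 1)) (↥(pbox (fine Lc (Mc B))) × Fin (3 + 1)) ℝ)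
    (hGw₁f : ∀ n : ℕ, ∀ B : ℕ, ∀ v, ((Gw₁f n) B) v = ((((L n) B) * (((H₁f n) B) v) - ((S n) B) * (fromRows (((Q₁₁f n) B) v) (0 : Matrix (NParam Lc (fine Lc (fine Lc (Mc B))) (fun k => (fun _ : ℕ => ctrOff (3 + 1) Lc) (k + 1)) n) (↥(pbox (towerTorus Lc (fine Lc (Mc B)) (n + 1))) × Fin (3 + 1)) ℝ))) * ((I n) B) + ((L n) B) * (fromRows (((Q₁₁f n) B) v) (0 : Matrix (NParam Lc (fine Lc (fine Lc (Mc B))) (fun k => (fun _ : ℕ => ctrOff (3 + 1) Lc) (k + 1)) n) (↥(pbox (towerTorus Lc (fine Lc (Mc B)) (n + 1))) × Fin (3 + 1)) ℝ))ᵀ * ((S n) B)).toBlocks₁₁)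
    (Gw₂f : ∀ n : ℕ, ∀ B : ℕ, ((↥(pbox (Mc B)) × Fin (3 + 1)) → ℝ) → ((↥(pbox (Mc B)) × Fin (3 + 1)) → ℝ) → Matrix (↥(pbox (fine Lc (Mc B))) × Fin (3 + 1)) (↥(pbox (fine Lc (Mc B))) × Fin (3 + 1)) ℝ)
    (hGw₂f : ∀ n : ℕ, ∀ B : ℕ, ∀ v v', ((Gw₂f n) B) v v' = ((((-((((L n) B) * (((H₁f n) B) v) - ((S n) B) * (fromRows (((Q₁₁f n) B) v) (0 : Matrix (NParam Lc (fine Lc (fine Lc (Mc B))) (fun k => (fun _ : ℕ => ctrOff (3 + 1) Lc) (k + 1)) n) (↥(pbox (towerTorus Lc (fine Lc (Mc B)) (n + 1))) × Fin (3 + 1)) ℝ))) * ((Γ n) B) - ((L n) B) * (fromRows (((Q₁₁f n) B) v) (0 : Matrix (NParam Lc (fine Lc (fine Lc (Mc B))) (fun k => (fun _ : ℕ => ctrOff (3 + 1) Lc) (k + 1)) n) (↥(pbox (towerTorus Lc (fine Lc (Mc B)) (n + 1))) × Fin (3 + 1)) ℝ))ᵀ * ((L n) B)) * (((H₁f n)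 B) v') + ((L n) B) * (((H₂f n) B) v v') - (((((L n) B) * (((H₁f n) B) v) - ((S n) B) * (fromRows (((Q₁₁f n) B) v) (0 : Matrix (NParam Lc (fine Lc (fine Lc (Mc B))) (fun k => (fun _ : ℕ => ctrOff (3 + 1) Lc) (k + 1)) n) (↥(pbox (towerTorus Lc (fine Lc (Mc B)) (n + 1))) × Fin (3 + 1)) ℝ))) * ((I n) B) + ((L n) B) * (fromRows (((Q₁₁f n) B) v) (0 : Matrix (NParam Lc (fine Lc (fine Lc (Mc B))) (fun k => (fun _ : ℕ => ctrOff (3 + 1) Lc) (k + 1)) n) (↥(pbox (towerTorus Lc (fine Lc (Mc B)) (n + 1))) × Fin (3 + 1)) ℝ))ᵀ * ((S n) B)) * (fromRows (((Q₁₁f n) B) v') (0 : Matrix (NParam Lc (fine Lc (fine Lc (Mc B))) (fun k => (fun _ : ℕ => ctrOff (3 + 1) Lc) (k + 1)) n) (↥(pbox (towerTorus Lc (fine Lc (Mc B)) (n + 1))) × Fin (3 + 1)) ℝ)) + ((S n) B) * (fromRows (((Q₁₂f n) B) v v') (0 : Matrix (NParam Lc (fine Lc (fine Lc (Mc B)))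 (fun k => (fun _ : ℕ => ctrOff (3 + 1) Lc) (k + 1)) n) (↥(pbox (towerTorus Lc (fine Lc (Mc B)) (n + 1))) × Fin (3 + 1)) ℝ)))) * ((I n) B) + (((L n) B) * (((H₁f n) B) v) - ((S n) B) * (fromRows (((Q₁₁f n) B) v) (0 : Matrix (NParam Lc (fine Lc (fine Lc (Mc B))) (fun k => (fun _ : ℕ => ctrOff (3 + 1) Lc) (k + 1)) n) (↥(pbox (towerTorus Lc (fine Lc (Mc B)) (n + 1))) × Fin (3 + 1)) ℝ))) * (-((((Γ n) B) * (((H₁f n) B) v') + ((I n) B) * (fromRows (((Q₁₁f n) B) v') (0 : Matrix (NParam Lc (fine Lc (fine Lc (Mc B))) (fun k => (fun _ : ℕ => ctrOff (3 + 1) Lc) (k + 1)) n) (↥(pbox (towerTorus Lc (fine Lc (Mc B)) (n + 1))) × Fin (3 + 1)) ℝ))) * ((I n) B) + ((Γ n) B) * (fromRows (((Q₁₁f n) B) v') (0 : Matrix (NParam Lc (fine Lc (fine Lc (Mc B))) (fun k => (fun _ : ℕ => ctrOff (3 + 1) Lc) (k + 1)) n) (↥(pbox (towerTorus Lc (fine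 Lc (Mc B)) (n + 1))) × Fin (3 + 1)) ℝ))ᵀ * ((S n) B)))) - ((-((((L n) B) * (((H₁f n) B) v) - ((S n) B) * (fromRows (((Q₁₁f n) B) v) (0 : Matrix (NParam Lc (fine Lc (fine Lc (Mc B))) (fun k => (fun _ : ℕ => ctrOff (3 + 1) Lc) (k + 1)) n) (↥(pbox (towerTorus Lc (fine Lc (Mc B)) (n + 1))) × Fin (3 + 1)) ℝ))) * ((Γ n) B) - ((L n) B) * (fromRows (((Q₁₁f n) B) v) (0 : Matrix (NParam Lc (fine Lc (fine Lc (Mc B))) (fun k => (fun _ : ℕ => ctrOff (3 + 1) Lc) (k + 1)) n) (↥(pbox (towerTorus Lc (fine Lc (Mc B)) (n + 1))) × Fin (3 + 1)) ℝ))ᵀ * ((L n) B)) * (-(fromRows (((Q₁₁f n) B) v') (0 : Matrix (NParam Lc (fine Lc (fine Lc (Mc B))) (fun k => (fun _ : ℕ => ctrOff (3 + 1) Lc) (k + 1)) n) (↥(pbox (towerTorus Lc (fine Lc (Mc B)) (n + 1))) × Fin (3 + 1)) ℝ))ᵀ) + ((L n) B) * (fromRows (((Q₁₂f n) B) v v')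 (0 : Matrix (NParam Lc (fine Lc (fine Lc (Mc B))) (fun k => (fun _ : ℕ => ctrOff (3 + 1) Lc) (k + 1)) n) (↥(pbox (towerTorus Lc (fine Lc (Mc B)) (n + 1))) × Fin (3 + 1)) ℝ))ᵀ) * ((S n) B) + ((L n) B) * (-(fromRows (((Q₁₁f n) B) v) (0 : Matrix (NParam Lc (fine Lc (fine Lc (Mc B))) (fun k => (fun _ : ℕ => ctrOff (3 + 1) Lc) (k + 1)) n) (↥(pbox (towerTorus Lc (fine Lc (Mc B)) (n + 1))) × Fin (3 + 1)) ℝ))ᵀ) * ((((L n) B) * (((H₁f n) B) v') - ((S n) B) * (fromRows (((Q₁₁f n) B) v') (0 : Matrix (NParam Lc (fine Lc (fine Lc (Mc B))) (fun k => (fun _ : ℕ => ctrOff (3 + 1) Lc) (k + 1)) n) (↥(pbox (towerTorus Lc (fine Lc (Mc B)) (n + 1))) × Fin (3 + 1)) ℝ))) * ((I n) B) + ((L n) B) * (fromRows (((Q₁₁f n) B) v') (0 : Matrix (NParam Lc (fine Lc (fine Lc (Mc B))) (fun k => (fun _ : ℕ => ctrOff (3 + 1) Lc) (k + 1)) n)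 (↥(pbox (towerTorus Lc (fine Lc (Mc B)) (n + 1))) × Fin (3 + 1)) ℝ))ᵀ * ((S n) B))))).toBlocks₁₁)
    -- #21's H-SIDE ROWS, FOR EVERY DIRECTION — DISPLAYED (R-FP-74∕75: `H₁f ∕ H₂f` are the TOTAL graded slots; their naming is the row's (C1) Hessian-table word): form parities, graded Ward rows
    (a2 : ∀ n : ℕ, ∀ B : ℕ, ∀ v, ((H₂f n) B) v v * ((W₀ n) B) + (2 : ℝ) • (((H₁f n) B) v * ((W₁f n) B) v) + ((H₀ n) B) * ((W₂f n) B) v = -((2 : ℝ) • ((((𝔔₁f n) B) v)ᵀ * (0 : Matrix ((↥(pbox (Mc B)) × Fin (3 + 1))) (NParam Lc (fine Lc (Mc B)) (fun _ : ℕ => ctrOff (3 + 1) Lc) (n + 1)) ℝ))) + ((𝔔₀ n) B)ᵀ * ((Y₂f n) B) v)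
    -- THE H-SIDE AT THE TOTAL SLOT (SPEC-46 §C ∕ SPEC-47 §B): the storey data `cf w κ hb` DISPLAYED by their closed forms `hcfe hwe hκe hhbe` (v6; `TowerHLinkRows`' letters), the PIN `hH₁f`; v5's storey rows `hcf hκ hκn hbl`∕top∕`K1 hlink`, `hH₁l hH₁t a1`, `hHN₁` DISCHARGED inside
    (hLc2 : 2 ≤ Lc)
    (cf : ∀ n : ℕ, ∀ B : ℕ, ℕ → (Fin (3 + 1) → Site (3 + 1) → Fin (3 + 1) → Site (3 + 1) → ℝ))
    (hcfe : ∀ n : ℕ, ∀ B : ℕ, ∀ (k : ℕ) (μ : Fin (3 + 1)) (s : Site (3 + 1)) (κ' : Fin (3 + 1)) (x : Site (3 + 1)), (cf n) B k μ s κ' x = if k = n + 1 then ∑ ν : Fin (3 + 1), ∑' w : Site (3 + 1), lamCoeffOf (KInv (N := Lc ^ (n + 1 + 1)) (d := 3)) (Lc ^ (n + 1 + 1)) ν w κ' x * compLinKer (fun _ => symLinKerAt (toSite (Roots.ctr Lc).r) Lc) Lc (n + 1) (μ, s) (ν, w) else (if x = (Lc : ℤ) • s ∧ κ' = μ then (1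 : ℝ) else 0))
    (w κ : ∀ n : ℕ, ℕ → ℝ)
    (hκe : ∀ n : ℕ, ∀ k, (κ n) k = ∏ i ∈ Finset.Ico k (n + 1), (stepScale 3 Lc (n + 1 - (i + 1)) * ((box (3 + 1) Lc).card : ℝ)))
    (hwe : ∀ n : ℕ, ∀ k, (w n) k = (-((c n) * ((Lc : ℝ) ^ (3 + 1)) ^ (n + 1 + 1)) / ∏ i ∈ Finset.Ico k (n + 1), (stepScale 3 Lc (n + 1 - (i + 1)) * (Lc : ℝ) ^ (3 + 1))) / (κ n) k)
    {rH : Fin (3 + 1) → ℕ} (hrH : rH ∈ box (3 + 1) Lc)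
    (hb : ∀ n : ℕ, ∀ B : ℕ, (k : ℕ) → ((↥(pbox (Mc B)) × Fin (3 + 1)) → ℝ) → (↥(pbox (towerTorus Lc (fine Lc (Mc B)) k)) × Fin (3 + 1) → ℝ))
    (hhbe : ∀ n : ℕ, ∀ B : ℕ, ∀ (k : ℕ) (v : ((↥(pbox (Mc B)) × Fin (3 + 1)) → ℝ)) (ā : ↥(pbox (towerTorus Lc (fine Lc (Mc B)) k)) × Fin (3 + 1)), ((hb n) B) k v ā = if k = n + 1 then ((hv n) B) v (wrapPt (towerTorus Lc (fine Lc (Mc B)) (n + 1)) (ā.1 : Site (3 + 1)), ā.2) else ∑ y₀ : ↥(pbox (towerTorus Lc (Mc B) k)), (if (ā.1 : Site (3 + 1)) = (Lc : ℤ) • (y₀ : Site (3 + 1)) then ∑ a : ↥(pbox (Mc B)) × Fin (3 + 1), v a * ∑' nn : Site (3 + 1), ∑ ν : Fin (3 + 1), ∑' w : Site (3 + 1), (∑ κ' : Fin (3 + 1), ∑' u' : Site (3 + 1), AN (Roots.ctr Lc) (n + 1) u' (((Lc ^ (n + 1 + 1) : ℕ) : ℤ) • (a.1 : Site (3 + 1)))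 (Sum.inl κ') (Sum.inr a.2) * lamCoeffOf (KInv (N := Lc ^ (n + 1 + 1)) (d := 3)) (Lc ^ (n + 1 + 1)) ν w κ' u') * compLinKer (fun _ => symLinKerAt (toSite (Roots.ctr Lc).r) Lc) Lc k (ā.2, translate (towerTorus Lc (Mc B) k) (y₀ : Site (3 + 1)) nn) (ν, w) else 0))
    (hH₁f : ∀ n : ℕ, ∀ B : ℕ, ∀ v, ((H₁f n) B) v = (((-2 * (c n)) • ∑ b : ↥(pbox (towerTorus Lc (fine Lc (Mc B)) (n + 1))) × Fin (3 + 1), ((hb n) B) (n + 1) v b • (perF (towerTorus Lc (fine Lc (Mc B)) (n + 1)) (dper (towerTorus Lc (fine Lc (Mc B)) (n + 1)) (wilsonA 3 b.2 (b.1 : Site (3 + 1))))).submatrix (fun b : ↥(pbox (towerTorus Lc (fine Lc (Mc B)) (n + 1))) × Fin (3 + 1) => ((b.1, Sum.inl b.2) : Idx (towerTorus Lc (fine Lc (Mc B)) (n + 1)) (Fib 3))) (fun b : ↥(pbox (towerTorus Lc (fine Lc (Mc B)) (n + 1))) × Fin (3 + 1) => ((b.1, Sum.inl b.2) : Idx (towerTorus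 Lc (fine Lc (Mc B)) (n + 1)) (Fib 3)))) + (w n) (n + 1) • ∑ ā : ↥(pbox (towerTorus Lc (fine Lc (Mc B)) (n + 1))) × Fin (3 + 1), ((hb n) B) (n + 1) v ā • (perF (towerTorus Lc (fine Lc (Mc B)) (n + 1)) (dper (towerTorus Lc (fine Lc (Mc B)) (n + 1)) (SLam N ((cf n) B (n + 1)) (fun μ y => symHessFFAt (toSite (ctrOff (3 + 1) Lc)) Lc μ y) ā.2 (ā.1 : Site (3 + 1))))).submatrix (fun b : ↥(pbox (towerTorus Lc (fine Lc (Mc B)) (n + 1))) × Fin (3 + 1) => ((b.1, Sum.inl b.2) : Idx (towerTorus Lc (fine Lc (Mc B)) (n + 1)) (Fib 3))) (fun b : ↥(pbox (towerTorus Lc (fine Lc (Mc B)) (n + 1))) × Fin (3 + 1) => ((b.1, Sum.inl b.2) : Idx (towerTorus Lc (fine Lc (Mc B)) (n + 1)) (Fib 3))) + compSumSym Lc (onTowerFamily Lc (fine Lc (Mc B)) (fun k => (w n) k • ∑ ā : ↥(pbox (towerTorus Lc (fine Lc (Mc B)) k)) × Fin (3 + 1), ((hb n) B) k v ā • (perF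 (towerTorus Lc (fine Lc (Mc B)) k) (dper (towerTorus Lc (fine Lc (Mc B)) k) (SLam N ((cf n) B k) (fun μ y => symHessFFAt (toSite (ctrOff (3 + 1) Lc)) Lc μ y) ā.2 (ā.1 : Site (3 + 1))))).submatrix (fun b : ↥(pbox (towerTorus Lc (fine Lc (Mc B)) k)) × Fin (3 + 1) => ((b.1, Sum.inl b.2) : Idx (towerTorus Lc (fine Lc (Mc B)) k) (Fib 3))) (fun b : ↥(pbox (towerTorus Lc (fine Lc (Mc B)) k)) × Fin (3 + 1) => ((b.1, Sum.inl b.2) : Idx (towerTorus Lc (fine Lc (Mc B)) k) (Fib 3))))) (fine Lc (Mc B)) (fun i : ℕ => n + 1 - i) (fun _ : ℕ => ctrOff (3 + 1) Lc) (n + 1)))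
    (hR₂ : ∀ n : ℕ, ∀ B : ℕ, ∀ a a' : ↥(pbox (Mc B)) × Fin (3 + 1), ∑ β : ↥(pbox (Mc B)) × Fin (3 + 1), (perF (towerTorus Lc (fine Lc (Mc B)) (n + 1)) (AN (Roots.ctr Lc) (n + 1)) (wrapPt (towerTorus Lc (fine Lc (Mc B)) (n + 1)) (((Lc ^ (n + 1 + 1) : ℕ) : ℤ) • (β.1 : Site (3 + 1))), Sum.inr β.2) (wrapPt (towerTorus Lc (fine Lc (Mc B)) (n + 1)) (((Lc ^ (n + 1 + 1) : ℕ) : ℤ) • (a'.1 : Site (3 + 1))), Sum.inr a'.2) • ∑ s : ↥(pbox (towerTorus Lc (fine Lc (Mc B)) (n + 1))), ((lv n) B) ((r n) • (Pi.single a (1 : ℝ) : ((↥(pbox (Mc B)) × Fin (3 + 1)) → ℝ))) s • ((Rs n) B) s β + perF (towerTorus Lc (fine Lc (Mc B)) (n + 1)) (AN (Roots.ctr Lc) (n + 1)) (wrapPt (towerTorus Lc (fine Lc (Mc B)) (n + 1)) (((Lc ^ (n + 1 + 1) : ℕ) : ℤ) • (β.1 : Site (3 + 1))), Sum.inr β.2)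 (wrapPt (towerTorus Lc (fine Lc (Mc B)) (n + 1)) (((Lc ^ (n + 1 + 1) : ℕ) : ℤ) • (a.1 : Site (3 + 1))), Sum.inr a.2) • ∑ s : ↥(pbox (towerTorus Lc (fine Lc (Mc B)) (n + 1))), ((lv n) B) ((r n) • (Pi.single a' (1 : ℝ) : ((↥(pbox (Mc B)) × Fin (3 + 1)) → ℝ))) s • ((Rs n) B) s β) = 0)
    -- the direction FAMILY (SPEC-46 §B′): one top one-shot source direction per label `(μ, y)`, per storey and per box (the row's transported directions, DISPLAYED)
    (dv : ∀ n : ℕ, ∀ B : ℕ, (Fin (3 + 1) × (Fin (3 + 1) → ℤ)) → ((↥(pbox (Mc B)) × Fin (3 + 1)) → ℝ))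
    (hdv : ∀ n : ℕ, ∀ B : ℕ, ∀ (μ : Fin (3 + 1)) (y : Site (3 + 1)), ((dv n) B) (μ, y) = (r n) • (Pi.single (wrapPt (Mc B) y, μ) (1 : ℝ) : ((↥(pbox (Mc B)) × Fin (3 + 1)) → ℝ)))
    -- (S3-1) N — per box: the ONE-SHOT system of depth `n+2`, right inverse and LEG over the box-free chart kernel `A_N` under the torus rules (DISPLAYED);
    {XN : ∀ n : ℕ, ∀ B : ℕ, Matrix ((↥(pbox (towerTorus Lc (fine Lc (Mc B)) (n + 1))) × Fin (3 + 1)) ⊕ ((↥(pbox (Mc B)) × Fin (3 + 1)) ⊕ (NParam Lc (fine Lc (Mc B)) (fun _ : ℕ => ctrOff (3 + 1) Lc) (n + 1)))) ((↥(pbox (towerTorus Lc (fine Lc (Mc B)) (n + 1))) × Fin (3 + 1)) ⊕ ((↥(pbox (Mc B)) × Fin (3 + 1)) ⊕ (NParam Lc (fine Lc (Mc B)) (fun _ : ℕ => ctrOff (3 + 1) Lc) (n + 1)))) ℝ}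
    (hXN : ∀ n : ℕ, ∀ B : ℕ, kkt ((H₀ n) B) (fromRows ((𝔔₀ n) B) ((P n) B)) * (XN n) B = 1)
    (ρN : ∀ n : ℕ, Fin (3 + 1) → ℤ)
    (fN : ∀ n : ℕ, ∀ B : ℕ, (↥(pbox (Mc B)) × Fin (3 + 1)) → Idx (towerTorus Lc (fine Lc (Mc B)) (n + 1)) (Fib 3))
    (hfN : ∀ n : ℕ, ∀ B : ℕ, ∀ a : ↥(pbox (Mc B)) × Fin (3 + 1), (fN n) B a = (wrapPt (towerTorus Lc (fine Lc (Mc B)) (n + 1)) (((Lc ^ (n + 1 + 1) : ℕ) : ℤ) • (a.1 : Site (3 + 1))), Sum.inr a.2))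
    (hEAN : ∀ n : ℕ, ∀ B : ℕ, perF (towerTorus Lc (fine Lc (Mc B)) (n + 1)) (axEc (ρN n) (Lc ^ (n + 1 + 1))) * perF (towerTorus Lc (fine Lc (Mc B)) (n + 1)) (AN (Roots.ctr Lc) (n + 1)) = perF (towerTorus Lc (fine Lc (Mc B)) (n + 1)) (AN (Roots.ctr Lc) (n + 1)))
    (hAEN : ∀ n : ℕ, ∀ B : ℕ, perF (towerTorus Lc (fine Lc (Mc B)) (n + 1)) (AN (Roots.ctr Lc) (n + 1)) * perF (towerTorus Lc (fine Lc (Mc B)) (n + 1)) (axEc (ρN n) (Lc ^ (n + 1 + 1))) = perF (towerTorus Lc (fine Lc (Mc B)) (n + 1)) (AN (Roots.ctr Lc) (n + 1)))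
    (hLN : ∀ n : ℕ, ∀ B : ℕ, ((XN n) B).submatrix (Sum.map id Sum.inl) (Sum.map id Sum.inl) = fromBlocks (Matrix.of fun (b b' : (↥(pbox (towerTorus Lc (fine Lc (Mc B)) (n + 1))) × Fin (3 + 1))) => axEc (ρN n) (Lc ^ (n + 1 + 1)) (b.1 : Site (3 + 1)) (b.1 : Site (3 + 1)) (Sum.inl b.2) (Sum.inl b.2) * (axEc (ρN n) (Lc ^ (n + 1 + 1)) (b'.1 : Site (3 + 1)) (b'.1 : Site (3 + 1)) (Sum.inl b'.2) (Sum.inl b'.2) * perF (towerTorus Lc (fine Lc (Mc B)) (n + 1)) (AN (Roots.ctr Lc) (n + 1)) (b.1, Sum.inl b.2) (b'.1, Sum.inl b'.2))) (Matrix.of fun (b : (↥(pbox (towerTorus Lc (fine Lc (Mc B)) (n + 1))) × Fin (3 + 1))) (a : (↥(pbox (Mc B)) × Fin (3 + 1))) => axEc (ρN n) (Lc ^ (n + 1 + 1)) (b.1 : Site (3 + 1)) (b.1 : Site (3 + 1)) (Sum.inl b.2) (Sum.inl b.2) * perF (towerTorus Lc (fine Lc (Mc B)) (n + 1)) (AN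 (Roots.ctr Lc) (n + 1)) (b.1, Sum.inl b.2) (((fN n) B) a)) (-Matrix.of fun (a : (↥(pbox (Mc B)) × Fin (3 + 1))) (b : (↥(pbox (towerTorus Lc (fine Lc (Mc B)) (n + 1))) × Fin (3 + 1))) => axEc (ρN n) (Lc ^ (n + 1 + 1)) (b.1 : Site (3 + 1)) (b.1 : Site (3 + 1)) (Sum.inl b.2) (Sum.inl b.2) * perF (towerTorus Lc (fine Lc (Mc B)) (n + 1)) (AN (Roots.ctr Lc) (n + 1)) (((fN n) B) a) (b.1, Sum.inl b.2)) (-((perF (towerTorus Lc (fine Lc (Mc B)) (n + 1)) (AN (Roots.ctr Lc) (n + 1))).submatrix ((fN n) B) ((fN n) B))))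
    -- (S3-2) N — FAMILY FORM (SPEC-46 §B′): an2's jets `VN ∕ WN (n+1)` are VERTEX FAMILIES; their parity ∕ winding letters DISPLAYED; the four content rows `hHN₁ hQN₁ hHN₂ hQN₂` of v5 are DISCHARGED inside (v6)
    {NN : ℕ → ℕ} {CvN CwN δN : ℕ → ℝ}
    (hVN : ∀ n : ℕ, VertexFamily (VN (Roots.ctr Lc) Pn (n + 1)) (NN n) (CvN n) (δN n))
    (hWN : ∀ n : ℕ, VertexFamily₂ (WN (Roots.ctr Lc) Pn (n + 1)) (NN n) (CwN n) (δN n))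
    (hδN : ∀ n : ℕ, 0 < δN n)
    (hWNw : ∀ (n : ℕ) (μ ν : Fin (3 + 1)) (z : Fin (3 + 1) → ℤ), Tendsto (fun B : ℕ => Matrix.trace (perF (towerTorus Lc (fine Lc (Mc B)) (n + 1)) (AN (Roots.ctr Lc) (n + 1)) * perF (towerTorus Lc (fine Lc (Mc B)) (n + 1)) (dper (towerTorus Lc (fine Lc (Mc B)) (n + 1)) (fun x w a b => ∑' e : Site (3 + 1), ((1 / 2 : ℝ) • (WN (Roots.ctr Lc) Pn (n + 1) μ 0 ν (translate (Mc B) z e) + sgnK (trK (WN (Roots.ctr Lc) Pn (n + 1) μ 0 ν (translate (Mc B) z e))))) x w a b))) - Matrix.trace (perF (towerTorus Lc (fine Lc (Mc B)) (n + 1)) (AN (Roots.ctr Lc) (n + 1)) * perF (towerTorus Lc (fine Lc (Mc B)) (n + 1)) (dper (towerTorus Lc (fine Lc (Mc B)) (n + 1)) ((1 / 2 : ℝ) • (WN (Roots.ctr Lc) Pn (n + 1) μ 0 ν z + sgnK (trK (WN (Roots.ctr Lc) Pn (n + 1) μ 0 ν z))))))) atTop (𝓝 0))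
    (hVNm : ∀ (n : ℕ) (μ : Fin (3 + 1)) (y : Fin (3 + 1) → ℤ), ∀ B : ℕ, ∀ a a' : (↥(pbox (Mc B)) × Fin (3 + 1)), (perF (towerTorus Lc (fine Lc (Mc B)) (n + 1)) (dper (towerTorus Lc (fine Lc (Mc B)) (n + 1)) ((VN (Roots.ctr Lc) Pn (n + 1)) μ y))) (((fN n) B) a) (((fN n) B) a') = 0)
    (hVNt : ∀ (n : ℕ) (μ : Fin (3 + 1)) (y : Fin (3 + 1) → ℤ), ∀ B : ℕ, ∀ (b : (↥(pbox (towerTorus Lc (fine Lc (Mc B)) (n + 1))) × Fin (3 + 1))) (a : (↥(pbox (Mc B)) × Fin (3 + 1))), (perF (towerTorus Lc (fine Lc (Mc B)) (n + 1)) (dper (towerTorus Lc (fine Lc (Mc B)) (n + 1)) ((VN (Roots.ctr Lc) Pn (n + 1)) μ y))) (b.1, Sum.inl b.2) (((fN n) B) a) = (perF (towerTorus Lc (fine Lc (Mc B)) (n + 1)) (dper (towerTorus Lc (fine Lc (Mc B)) (n + 1)) ((VN (Roots.ctr Lc) Pn (n + 1)) μ y))) (((fN n) B) a) (b.1, Sum.inl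 b.2))
    -- (S3-1) F — per box: the ONE-SHOT system of the tower below (depth `n+1`, same finest torus), right inverse and LEG over `A_F` (DISPLAYED);
    {XF : ∀ n : ℕ, ∀ B : ℕ, Matrix ((↥(pbox (towerTorus Lc (fine Lc (Mc B)) (n + 1))) × Fin (3 + 1)) ⊕ ((↥(pbox (fine Lc (Mc B))) × Fin (3 + 1)) ⊕ (NParam Lc (fine Lc (fine Lc (Mc B))) (fun k => (fun _ : ℕ => ctrOff (3 + 1) Lc) (k + 1)) n))) ((↥(pbox (towerTorus Lc (fine Lc (Mc B)) (n + 1))) × Fin (3 + 1)) ⊕ ((↥(pbox (fine Lc (Mc B))) × Fin (3 + 1)) ⊕ (NParam Lc (fine Lc (fine Lc (Mc B))) (fun k => (fun _ : ℕ => ctrOff (3 + 1) Lc) (k + 1)) n))) ℝ}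
    (hXF : ∀ n : ℕ, ∀ B : ℕ, kkt ((H₀ n) B) (fromRows ((Q₁₀ n) B) ((τ₁ n) B)) * (XF n) B = 1)
    (ρF : ∀ n : ℕ, Fin (3 + 1) → ℤ)
    (LFc : ∀ n : ℕ, ℕ)
    (fF : ∀ n : ℕ, ∀ B : ℕ, (↥(pbox (fine Lc (Mc B))) × Fin (3 + 1)) → Idx (towerTorus Lc (fine Lc (Mc B)) (n + 1)) (Fib 3))
    (hfF : ∀ n : ℕ, ∀ B : ℕ, Function.Injective ((fF n) B))
    (hmF : ∀ n : ℕ, ∀ B : ℕ, ∀ a : (↥(pbox (fine Lc (Mc B))) × Fin (3 + 1)), ∃ m : Fin (3 + 1), ((fF n) B a).2 = Sum.inr m)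
    (hcF : ∀ n : ℕ, ∀ B : ℕ, ∀ (s : ↥(pbox (towerTorus Lc (fine Lc (Mc B)) (n + 1)))) (m : Fin (3 + 1)), ((s, Sum.inr m) : Idx (towerTorus Lc (fine Lc (Mc B)) (n + 1)) (Fib 3)) ∈ Set.range ((fF n) B) ↔ Torus.proj (LFc n) (s : Site (3 + 1)) = 0)
    {CAF αF : ∀ n : ℕ, ℝ}
    (hAF : ∀ n : ℕ, Decays (AF (n + 1)) (CAF n) (αF n))
    (hαF : ∀ n : ℕ, 0 < (αF n))
    (hAFsh : ∀ n : ℕ, ∀ t : Fin (3 + 1) → ℤ, shiftK (((Lc ^ (n + 1) : ℕ) : ℤ) • t) (AF (n + 1)) = (AF (n + 1)))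
    (hEAF : ∀ n : ℕ, ∀ B : ℕ, perF (towerTorus Lc (fine Lc (Mc B)) (n + 1)) (axEc (ρF n) (LFc n)) * perF (towerTorus Lc (fine Lc (Mc B)) (n + 1)) (AF (n + 1)) = perF (towerTorus Lc (fine Lc (Mc B)) (n + 1)) (AF (n + 1)))
    (hAEF : ∀ n : ℕ, ∀ B : ℕ, perF (towerTorus Lc (fine Lc (Mc B)) (n + 1)) (AF (n + 1)) * perF (towerTorus Lc (fine Lc (Mc B)) (n + 1)) (axEc (ρF n) (LFc n)) = perF (towerTorus Lc (fine Lc (Mc B)) (n + 1)) (AF (n + 1)))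
    (hLF : ∀ n : ℕ, ∀ B : ℕ, ((XF n) B).submatrix (Sum.map id Sum.inl) (Sum.map id Sum.inl) = fromBlocks (Matrix.of fun (b b' : (↥(pbox (towerTorus Lc (fine Lc (Mc B)) (n + 1))) × Fin (3 + 1))) => axEc (ρF n) (LFc n) (b.1 : Site (3 + 1)) (b.1 : Site (3 + 1)) (Sum.inl b.2) (Sum.inl b.2) * (axEc (ρF n) (LFc n) (b'.1 : Site (3 + 1)) (b'.1 : Site (3 + 1)) (Sum.inl b'.2) (Sum.inl b'.2) * perF (towerTorus Lc (fine Lc (Mc B)) (n + 1)) (AF (n + 1)) (b.1, Sum.inl b.2) (b'.1, Sum.inl b'.2))) (Matrix.of fun (b : (↥(pbox (towerTorus Lc (fine Lc (Mc B)) (n + 1))) × Fin (3 + 1))) (a : (↥(pbox (fine Lc (Mc B))) × Fin (3 + 1))) => axEc (ρF n) (LFc n) (b.1 : Site (3 + 1)) (b.1 : Site (3 + 1)) (Sum.inl b.2) (Sum.inl b.2) * perF (towerTorus Lc (fine Lc (Mc B)) (n + 1)) (AF (n + 1)) (b.1, Sum.inl b.2) (((fF n) B) a)) (-Matrix.of fun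 (a : (↥(pbox (fine Lc (Mc B))) × Fin (3 + 1))) (b : (↥(pbox (towerTorus Lc (fine Lc (Mc B)) (n + 1))) × Fin (3 + 1))) => axEc (ρF n) (LFc n) (b.1 : Site (3 + 1)) (b.1 : Site (3 + 1)) (Sum.inl b.2) (Sum.inl b.2) * perF (towerTorus Lc (fine Lc (Mc B)) (n + 1)) (AF (n + 1)) (((fF n) B) a) (b.1, Sum.inl b.2)) (-((perF (towerTorus Lc (fine Lc (Mc B)) (n + 1)) (AF (n + 1))).submatrix ((fF n) B) ((fF n) B))))
    -- (S3-2) F — FAMILY FORM: the lattice jets `𝒱F ∕ 𝒲F (n+1)` of the tower below are vertex families at scale `NF n`; PER BOX their periodisations carry the parities and ARE the door's fine jets `H₁f ∕ Q₁₁f` (first order) and the symmetrised `H₂f ∕ Q₁₂f` (second order) along the family `dv n B (μ, y)`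
    {NF : ℕ → ℕ} {CvF CwF δF : ℕ → ℝ}
    (hVF : ∀ n : ℕ, VertexFamily (𝒱F (n + 1)) (NF n) (CvF n) (δF n))
    (hWF : ∀ n : ℕ, VertexFamily₂ (𝒲F (n + 1)) (NF n) (CwF n) (δF n))
    (hδF : ∀ n : ℕ, 0 < δF n)
    (hWFw : ∀ (n : ℕ) (μ ν : Fin (3 + 1)) (z : Fin (3 + 1) → ℤ), Tendsto (fun B : ℕ => Matrix.trace (perF (towerTorus Lc (fine Lc (Mc B)) (n + 1)) (AF (n + 1)) * perF (towerTorus Lc (fine Lc (Mc B)) (n + 1)) (dper (towerTorus Lc (fine Lc (Mc B)) (n + 1)) ((𝒲bF (n + 1)) B μ 0 ν z))) - Matrix.trace (perF (towerTorus Lc (fine Lc (Mc B)) (n + 1)) (AF (n + 1)) * perF (towerTorus Lc (fine Lc (Mc B)) (n + 1)) (dper (towerTorus Lc (fine Lc (Mc B)) (n + 1)) ((𝒲F (n + 1)) μ 0 ν z)))) atTop (𝓝 0))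
    (hVFm : ∀ (n : ℕ) (μ : Fin (3 + 1)) (y : Fin (3 + 1) → ℤ), ∀ B : ℕ, ∀ a a' : (↥(pbox (fine Lc (Mc B))) × Fin (3 + 1)), (perF (towerTorus Lc (fine Lc (Mc B)) (n + 1)) (dper (towerTorus Lc (fine Lc (Mc B)) (n + 1)) ((𝒱F (n + 1)) μ y))) (((fF n) B) a) (((fF n) B) a') = 0)
    (hVFt : ∀ (n : ℕ) (μ : Fin (3 + 1)) (y : Fin (3 + 1) → ℤ), ∀ B : ℕ, ∀ (b : (↥(pbox (towerTorus Lc (fine Lc (Mc B)) (n + 1))) × Fin (3 + 1))) (a : (↥(pbox (fine Lc (Mc B))) × Fin (3 + 1))), (perF (towerTorus Lc (fine Lc (Mc B)) (n + 1)) (dper (towerTorus Lc (fine Lc (Mc B)) (n + 1)) ((𝒱F (n + 1)) μ y))) (b.1, Sum.inl b.2) (((fF n) B) a) = (perF (towerTorus Lc (fine Lc (Mc B)) (n + 1)) (dper (towerTorus Lc (fine Lc (Mc B)) (n + 1)) ((𝒱F (n + 1)) μ y))) (((fF n) B) a) (b.1, Sum.inl b.2))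
    (hWFm : ∀ (n : ℕ) (μ : Fin (3 + 1)) (y : Fin (3 + 1) → ℤ) (ν : Fin (3 + 1)) (y' : Fin (3 + 1) → ℤ), ∀ B : ℕ, ∀ a a' : (↥(pbox (fine Lc (Mc B))) × Fin (3 + 1)), (perF (towerTorus Lc (fine Lc (Mc B)) (n + 1)) (dper (towerTorus Lc (fine Lc (Mc B)) (n + 1)) ((𝒲bF (n + 1)) B μ y ν y'))) (((fF n) B) a) (((fF n) B) a') = 0)
    (hWFt : ∀ (n : ℕ) (μ : Fin (3 + 1)) (y : Fin (3 + 1) → ℤ) (ν : Fin (3 + 1)) (y' : Fin (3 + 1) → ℤ), ∀ B : ℕ, ∀ (b : (↥(pbox (towerTorus Lc (fine Lc (Mc B)) (n + 1))) × Fin (3 + 1))) (a : (↥(pbox (fine Lc (Mc B))) × Fin (3 + 1))), (perF (towerTorus Lc (fine Lc (Mc B)) (n + 1)) (dper (towerTorus Lc (fine Lc (Mc B)) (n + 1)) ((𝒲bF (n + 1)) B μ y ν y'))) (b.1, Sum.inl b.2) (((fF n) B) a) = -(perF (towerTorus Lc (fine Lc (Mc B)) (n + 1)) (dper (towerTorus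 Lc (fine Lc (Mc B)) (n + 1)) ((𝒲bF (n + 1)) B μ y ν y'))) (((fF n) B) a) (b.1, Sum.inl b.2))
    (hHF₁ : ∀ (n : ℕ) (μ : Fin (3 + 1)) (y : Fin (3 + 1) → ℤ), ∀ B : ℕ, (H₁f n) B ((dv n) B (μ, y)) = (perF (towerTorus Lc (fine Lc (Mc B)) (n + 1)) (dper (towerTorus Lc (fine Lc (Mc B)) (n + 1)) ((𝒱F (n + 1)) μ y))).submatrix (fun b : (↥(pbox (towerTorus Lc (fine Lc (Mc B)) (n + 1))) × Fin (3 + 1)) => ((b.1, Sum.inl b.2) : Idx (towerTorus Lc (fine Lc (Mc B)) (n + 1)) (Fib 3))) (fun b : (↥(pbox (towerTorus Lc (fine Lc (Mc B)) (n + 1))) × Fin (3 + 1)) => ((b.1, Sum.inl b.2) : Idx (towerTorus Lc (fine Lc (Mc B)) (n + 1)) (Fib 3))))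
    (hQF₁ : ∀ (n : ℕ) (μ : Fin (3 + 1)) (y : Fin (3 + 1) → ℤ), ∀ B : ℕ, (Q₁₁f n) B ((dv n) B (μ, y)) = (perF (towerTorus Lc (fine Lc (Mc B)) (n + 1)) (dper (towerTorus Lc (fine Lc (Mc B)) (n + 1)) ((𝒱F (n + 1)) μ y))).submatrix ((fF n) B) (fun b : (↥(pbox (towerTorus Lc (fine Lc (Mc B)) (n + 1))) × Fin (3 + 1)) => ((b.1, Sum.inl b.2) : Idx (towerTorus Lc (fine Lc (Mc B)) (n + 1)) (Fib 3))))
    (hHF₂ : ∀ (n : ℕ) (μ : Fin (3 + 1)) (y : Fin (3 + 1) → ℤ) (ν : Fin (3 + 1)) (y' : Fin (3 + 1) → ℤ), ∀ B : ℕ, (1 / 2 : ℝ) • ((H₂f n) B ((dv n) B (μ, y)) ((dv n) B (ν, y')) + (H₂f n) B ((dv n) B (ν, y')) ((dv n) B (μ, y))) = (perF (towerTorus Lc (fine Lc (Mc B)) (n + 1)) (dper (towerTorus Lc (fine Lc (Mc B)) (n + 1)) ((𝒲bF (n + 1)) B μ y ν y'))).submatrix (fun b : (↥(pbox (towerTorus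 Lc (fine Lc (Mc B)) (n + 1))) × Fin (3 + 1)) => ((b.1, Sum.inl b.2) : Idx (towerTorus Lc (fine Lc (Mc B)) (n + 1)) (Fib 3))) (fun b : (↥(pbox (towerTorus Lc (fine Lc (Mc B)) (n + 1))) × Fin (3 + 1)) => ((b.1, Sum.inl b.2) : Idx (towerTorus Lc (fine Lc (Mc B)) (n + 1)) (Fib 3))))
    (hQF₂ : ∀ (n : ℕ) (μ : Fin (3 + 1)) (y : Fin (3 + 1) → ℤ) (ν : Fin (3 + 1)) (y' : Fin (3 + 1) → ℤ), ∀ B : ℕ, (1 / 2 : ℝ) • ((Q₁₂f n) B ((dv n) B (μ, y)) ((dv n) B (ν, y')) + (Q₁₂f n) B ((dv n) B (ν, y')) ((dv n) B (μ, y))) = (perF (towerTorus Lc (fine Lc (Mc B)) (n + 1)) (dper (towerTorus Lc (fine Lc (Mc B)) (n + 1)) ((𝒲bF (n + 1)) B μ y ν y'))).submatrix ((fF n) B) (fun b : (↥(pbox (towerTorus Lc (fine Lc (Mc B)) (n + 1))) × Fin (3 + 1)) => ((b.1, Sum.inl b.2) : Idx (towerTorus Lc (fine Lc (Mc B)) (n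 + 1)) (Fib 3))))
    -- (S3-2) G — FAMILY FORM: the lattice jets `𝒱G ∕ 𝒲G (n+1)` of the TOP STEP are vertex families at scale `NG n`; PER BOX their periodisations on `fine Lc (Mc B)` carry the parities and ARE the door's `G` jets `Gw₁f ∕ Q₂₁f`, `Gw₂f ∕ Q₂₂f` (with the tower weight `∏ wVH`) at the slots, along the family `dv n B (μ, y)`
    {NG : ℕ → ℕ} {CvG CwG δG : ℕ → ℝ}
    (hVG : ∀ n : ℕ, VertexFamily (𝒱G (n + 1)) (NG n) (CvG n) (δG n))
    (hWG : ∀ n : ℕ, VertexFamily₂ (𝒲G (n + 1)) (NG n) (CwG n) (δG n))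
    (hδG : ∀ n : ℕ, 0 < δG n)
    (hWGw : ∀ (n : ℕ) (μ ν : Fin (3 + 1)) (z : Fin (3 + 1) → ℤ), Tendsto (fun B : ℕ => Matrix.trace (perF (fine Lc (Mc B)) (GcombSh (d := 3) Lc ((n + 1 - 0))) * perF (fine Lc (Mc B)) (dper (fine Lc (Mc B)) ((𝒲bG (n + 1)) B μ 0 ν z))) - Matrix.trace (perF (fine Lc (Mc B)) (GcombSh (d := 3) Lc ((n + 1 - 0))) * perF (fine Lc (Mc B)) (dper (fine Lc (Mc B)) ((𝒲G (n + 1)) μ 0 ν z)))) atTop (𝓝 0))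
    (hVGm : ∀ (n : ℕ) (μ : Fin (3 + 1)) (y : Fin (3 + 1) → ℤ), ∀ B : ℕ, ∀ a a' : (↥(pbox (Mc B)) × Fin (3 + 1)), (perF (fine Lc (Mc B)) (dper (fine Lc (Mc B)) ((𝒱G (n + 1)) μ y))) (((coarsePt (Mc B) Lc a.1, Sum.inr (a.2)) : Idx (fine Lc (Mc B)) (Fib 3))) (((coarsePt (Mc B) Lc a'.1, Sum.inr (a'.2)) : Idx (fine Lc (Mc B)) (Fib 3))) = 0)
    (hVGt : ∀ (n : ℕ) (μ : Fin (3 + 1)) (y : Fin (3 + 1) → ℤ), ∀ B : ℕ, ∀ (b : (↥(pbox (fine Lc (Mc B))) × Fin (3 + 1))) (a : (↥(pbox (Mc B)) × Fin (3 + 1))), (perF (fine Lc (Mc B)) (dper (fine Lc (Mc B)) ((𝒱G (n + 1)) μ y))) (b.1, Sum.inl b.2) (((coarsePt (Mc B) Lc a.1, Sum.inr (a.2)) : Idx (fine Lc (Mc B)) (Fib 3))) = (perF (fine Lc (Mc B)) (dper (fine Lc (Mc B)) ((𝒱G (n + 1)) μ y))) (((coarsePt (Mc B) Lc a.1, Sum.inr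 (a.2)) : Idx (fine Lc (Mc B)) (Fib 3))) (b.1, Sum.inl b.2))
    (hWGm : ∀ (n : ℕ) (μ : Fin (3 + 1)) (y : Fin (3 + 1) → ℤ) (ν : Fin (3 + 1)) (y' : Fin (3 + 1) → ℤ), ∀ B : ℕ, ∀ a a' : (↥(pbox (Mc B)) × Fin (3 + 1)), (perF (fine Lc (Mc B)) (dper (fine Lc (Mc B)) ((𝒲bG (n + 1)) B μ y ν y'))) (((coarsePt (Mc B) Lc a.1, Sum.inr (a.2)) : Idx (fine Lc (Mc B)) (Fib 3))) (((coarsePt (Mc B) Lc a'.1, Sum.inr (a'.2)) : Idx (fine Lc (Mc B)) (Fib 3))) = 0)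
    (hWGt : ∀ (n : ℕ) (μ : Fin (3 + 1)) (y : Fin (3 + 1) → ℤ) (ν : Fin (3 + 1)) (y' : Fin (3 + 1) → ℤ), ∀ B : ℕ, ∀ (b : (↥(pbox (fine Lc (Mc B))) × Fin (3 + 1))) (a : (↥(pbox (Mc B)) × Fin (3 + 1))), (perF (fine Lc (Mc B)) (dper (fine Lc (Mc B)) ((𝒲bG (n + 1)) B μ y ν y'))) (b.1, Sum.inl b.2) (((coarsePt (Mc B) Lc a.1, Sum.inr (a.2)) : Idx (fine Lc (Mc B)) (Fib 3))) = -(perF (fine Lc (Mc B)) (dper (fine Lc (Mc B)) ((𝒲bG (n + 1)) B μ y ν y'))) (((coarsePt (Mc B) Lc a.1, Sum.inr (a.2)) : Idx (fine Lc (Mc B)) (Fib 3))) (b.1, Sum.inl b.2))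
    (hHG₁ : ∀ (n : ℕ) (μ : Fin (3 + 1)) (y : Fin (3 + 1) → ℤ), ∀ B : ℕ, (∏ i ∈ range (n + 1), wVH 3 Lc ((n + 1 - i))) • (Gw₁f n) B ((dv n) B (μ, y)) = (perF (fine Lc (Mc B)) (dper (fine Lc (Mc B)) ((𝒱G (n + 1)) μ y))).submatrix (fun b : (↥(pbox (fine Lc (Mc B))) × Fin (3 + 1)) => ((b.1, Sum.inl b.2) : Idx (fine Lc (Mc B)) (Fib 3))) (fun b : (↥(pbox (fine Lc (Mc B))) × Fin (3 + 1)) => ((b.1, Sum.inl b.2) : Idx (fine Lc (Mc B)) (Fib 3))))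
    (hQG₁ : ∀ (n : ℕ) (μ : Fin (3 + 1)) (y : Fin (3 + 1) → ℤ), ∀ B : ℕ, (Q₂₁f n) B ((dv n) B (μ, y)) = (perF (fine Lc (Mc B)) (dper (fine Lc (Mc B)) ((𝒱G (n + 1)) μ y))).submatrix (fun a : (↥(pbox (Mc B)) × Fin (3 + 1)) => (((coarsePt (Mc B) Lc a.1, Sum.inr (a.2)) : Idx (fine Lc (Mc B)) (Fib 3)))) (fun b : (↥(pbox (fine Lc (Mc B))) × Fin (3 + 1)) => ((b.1, Sum.inl b.2) : Idx (fine Lc (Mc B)) (Fib 3))))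
    (hHG₂ : ∀ (n : ℕ) (μ : Fin (3 + 1)) (y : Fin (3 + 1) → ℤ) (ν : Fin (3 + 1)) (y' : Fin (3 + 1) → ℤ), ∀ B : ℕ, (∏ i ∈ range (n + 1), wVH 3 Lc ((n + 1 - i))) • ((1 / 2 : ℝ) • ((Gw₂f n) B ((dv n) B (μ, y)) ((dv n) B (ν, y')) + (Gw₂f n) B ((dv n) B (ν, y')) ((dv n) B (μ, y)))) = (perF (fine Lc (Mc B)) (dper (fine Lc (Mc B)) ((𝒲bG (n + 1)) B μ y ν y'))).submatrix (fun b : (↥(pbox (fine Lc (Mc B))) × Fin (3 + 1)) => ((b.1, Sum.inl b.2) : Idx (fine Lc (Mc B)) (Fib 3))) (fun b : (↥(pbox (fine Lc (Mc B))) × Fin (3 + 1)) => ((b.1, Sum.inl b.2) : Idx (fine Lc (Mc B)) (Fib 3))))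
    (hQG₂ : ∀ (n : ℕ) (μ : Fin (3 + 1)) (y : Fin (3 + 1) → ℤ) (ν : Fin (3 + 1)) (y' : Fin (3 + 1) → ℤ), ∀ B : ℕ, (1 / 2 : ℝ) • ((Q₂₂f n) B ((dv n) B (μ, y)) ((dv n) B (ν, y')) + (Q₂₂f n) B ((dv n) B (ν, y')) ((dv n) B (μ, y))) = (perF (fine Lc (Mc B)) (dper (fine Lc (Mc B)) ((𝒲bG (n + 1)) B μ y ν y'))).submatrix (fun a : (↥(pbox (Mc B)) × Fin (3 + 1)) => (((coarsePt (Mc B) Lc a.1, Sum.inr (a.2)) : Idx (fine Lc (Mc B)) (Fib 3)))) (fun b : (↥(pbox (fine Lc (Mc B))) × Fin (3 + 1)) => ((b.1, Sum.inl b.2) : Idx (fine Lc (Mc B)) (Fib 3))))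
    -- END-Comp's other rows, VERBATIM (the anchor storey, the TRANSPORT clause, the top-step identification at `GcombSh Lc j`, (T0)(T1))
    (hF₁ : ∀ (μ ν : Fin 4) (z : Fin 4 → ℤ), hessKer (AF 1) (𝒱F 1) (𝒲F 1) μ ν z = (Lc : ℝ) ^ 8 * dressedEntry (wStep Lc 1) (TshotOf Lc (JcComp hLc N cΛ cB (Roots.ctr Lc) Pn) 1) ((Lc : ℤ) • z) μ ν)
    (htr : ∀ j : ℕ, 1 ≤ j → ∀ (μ ν : Fin 4) (z : Fin 4 → ℤ), hessKer (AF (j + 1)) (𝒱F (j + 1)) (𝒲F (j + 1)) μ ν z = (Lc : ℝ) ^ 8 * dressedEntry (wStep Lc (j + 1)) (hessKer (AN (Roots.ctr Lc) j) (VN (Roots.ctr Lc) Pn j) (WN (Roots.ctr Lc) Pn j)) ((Lc : ℤ) • z) μ ν)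
    (hG : ∀ j : ℕ, 1 ≤ j → ∀ (μ ν : Fin 4) (z : Fin 4 → ℤ), hessKer (GcombSh (d := 3) Lc j) (𝒱G j) (𝒲G j) μ ν z = TbalOf Lc (JsB12CombShSym hLc N (symTablesAn1S2 3 Lc cΛ) cΛ cB) j μ ν z)
    (hT0 : ∀ j (c e : Fin 4), HasSum (TbalOf Lc (JsB12CombShSym hLc N (symTablesAn1S2 3 Lc cΛ) cΛ cB) j c e) 0)
    (hT1 : ∀ j (c e ρ : Fin 4), HasSum (fun t : Fin 4 → ℤ => t ρ • TbalOf Lc (JsB12CombShSym hLc N (symTablesAn1S2 3 Lc cΛ) cΛ cB) j c e t) 0) :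
    D1Tel Lc (JsB12CombShSym hLc N (symTablesAn1S2 3 Lc cΛ) cΛ cB) (JcComp hLc N cΛ cB (Roots.ctr Lc) Pn) := by
  -- v7: v5's fifteen rows ∕ letters and the (J-Λ-fold) letter, DISCHARGED BY NAME at the road's row theorems ∕ an2's fold (shapes restated as `have`s; feeds = SPEC-58 §1); (J-ΛS) ∕ (J-X₂) fed in place (v7)
  have hfold : ∀ n : ℕ, ∀ B : ℕ, ∀ (μ : Fin (3 + 1)) (y : Site (3 + 1)) (κ₁ : Fin (3 + 1)) (s₁ : Site (3 + 1)), ∑ ā : ↥(pbox (towerTorus Lc (fine Lc (Mc B)) (n + 1))) × Fin (3 + 1), perF (towerTorus Lc (fine Lc (Mc B)) (n + 1)) (AN (Roots.ctr Lc) (n + 1)) (ā.1, Sum.inl ā.2) (wrapPt (towerTorus Lc (fine Lc (Mc B)) (n + 1)) (((Lc ^ (n + 1 + 1) : ℕ) : ℤ) • y), Sum.inr μ) * (∑' m : Site (3 + 1), ∑ ν : Fin (3 + 1), ∑' w : Site (3 + 1), lamCoeffOf (KInv (N := Lc ^ (n + 1 + 1)) (d := 3)) (Lc ^ (n + 1 +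 1)) ν w ā.2 (ā.1 : Site (3 + 1)) * compLinKer (fun _ => symLinKerAt (toSite (Roots.ctr Lc).r) Lc) Lc (n + 1) (κ₁, translate (towerTorus Lc (Mc B) (n + 1)) s₁ m) (ν, w)) = ∑' m : Site (3 + 1), ∑ ν : Fin (3 + 1), ∑' w : Site (3 + 1), (∑ κ' : Fin (3 + 1), ∑' u' : Site (3 + 1), AN (Roots.ctr Lc) (n + 1) u' (((Lc ^ (n + 1 + 1) : ℕ) : ℤ) • y) (Sum.inl κ') (Sum.inr μ) * lamCoeffOf (KInv (N := Lc ^ (n + 1 + 1)) (d := 3)) (Lc ^ (n + 1 + 1)) ν w κ' u') * compLinKer (fun _ => symLinKerAt (toSite (Roots.ctr Lc).r) Lc) Lc (n + 1) (κ₁, translate (towerTorus Lc (Mc B) (n + 1)) s₁ m) (ν, w) := fun n B μ y κ₁ s₁ => sum_perF_AN_mul_periodised_cf_eq_tower (R := Roots.ctr Lc) (j := n + 1) (Mc B) μ κ₁ y s₁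
  have hlv : ∀ n : ℕ, ∀ B : ℕ, ∀ (r : ℝ) (x y : ((↥(pbox (Mc B)) × Fin (3 + 1)) → ℝ)), ((lv n) B) (r • x + y) = r • ((lv n) B) x + ((lv n) B) y := by
    intro n B r' x y; funext s; simp only [Pi.add_apply, Pi.smul_apply, smul_eq_mul]; rw [(hlve n) B, (hlve n) B, (hlve n) B, show ((hv n) B) (r' • x + y) = r' • ((hv n) B) x + ((hv n) B) y from (by rw [(hhv n) B, (hhv n) B, (hhv n) B]; exact nestedColumn_linear _ _ r' x y)]
    simp only [Matrix.mulVec_add, Matrix.mulVec_smul, Pi.add_apply, Pi.smul_apply, smul_eq_mul]; rw [← Finset.sum_neg_distrib, ← Finset.sum_neg_distrib, ← Finset.sum_neg_distrib, Finset.mul_sum, ← Finset.sum_add_distrib]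
    exact Finset.sum_congr rfl fun x _ => by split_ifs <;> ring
  have hJW : ∀ n : ℕ, ∀ B : ℕ, ∀ (a : ↥(pbox (Mc B)) × Fin (3 + 1)) (b : ↥(pbox (towerTorus Lc (fine Lc (Mc B)) (n + 1))) × Fin (3 + 1)), ((hv n) B) (Pi.single a 1) b = perF (towerTorus Lc (fine Lc (Mc B)) (n + 1)) (AN (Roots.ctr Lc) (n + 1)) (b.1, Sum.inl b.2) (wrapPt (towerTorus Lc (fine Lc (Mc B)) (n + 1)) (((Lc ^ (n + 1 + 1) : ℕ) : ℤ) • (a.1 : Site (3 + 1))), Sum.inr a.2) - ∑ s : ↥(pbox (towerTorus Lc (fine Lc (Mc B)) (n + 1))), tgrad (towerTorus Lc (fine Lc (Mc B)) (n + 1)) (b.1, Sum.inl b.2) s * ((lv n) B) (Pi.single a 1) s := by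
    intro n B a b; have h := hv_single_apply_eq_of_NLeg_sym (d := 3) (M' := fine Lc (Mc B)) (Lc := Lc) (lev := fun i : ℕ => n + 1 - i) (n := n) (fun _ => (ctrOff_mem_box (d := 3 + 1) (Nat.one_le_iff_ne_zero.mpr (NeZero.ne Lc)))) (fun i hi => by show n + 1 - i = n + 1 - (i + 1) + 1; omega) (fun i => ⟨Mc B i, rfl⟩) (fun a : ↥(pbox (Mc B)) × Fin (3 + 1) => coarsePt (Mc B) Lc a.1) (fun a : ↥(pbox (Mc B)) × Fin (3 + 1) => a.2) (coarseSlot_injective (Mc B)) (coarseSlot_range (Mc B)) ((hH₀ n) B) ((hQ₁₀ n) B) ((hτ₁ n) B) ((hτ₂ n) B) ((hQ₂₀ n) B) ((hW₀ n) B) ((hP n) B) ((h𝔔₀ n) B) ((hI n) B) ((hS n) B) ((hhv n) B) ((hXN n) B) (ρN n) (Lc ^ (n + 1 + 1)) (AN (Roots.ctr Lc) (n + 1)) ((fN n) B) ((hEAN n) B) ((hLN n) B) 1 a b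
    simp only [one_smul, one_mul] at h; rw [h, (hfN n) B a]; exact congrArg₂ (· - ·) rfl (Finset.sum_congr rfl fun s _ => by rw [(hlve n) B])
  have hcf : ∀ n : ℕ, ∀ B : ℕ, ∀ k κ' u μ y, Summable fun m : Site (3 + 1) => (cf n) B k μ (translate (towerTorus Lc (Mc B) k) y m) κ' u := fun n B k κ' u μ y => cf_summable (R := Roots.ctr Lc) (n := n) (M := Mc B) (cfF := (cf n) B) (hcfF := (hcfe n) B) k κ' u μ y
  have hκ : ∀ n : ℕ, ∀ k, k < n + 1 → (κ n) k = stepScale 3 Lc (n + 1 - (k + 1)) * ((box (3 + 1) Lc).card : ℝ) * (κ n) (k + 1) := fun n k hk => kappa_row n (κ n) (hκe n) k hk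
  have hκn : ∀ n : ℕ, (κ n) (n + 1) = 1 := fun n => kappa_top n (κ n) (hκe n)
  have hbl : ∀ n : ℕ, ∀ B : ℕ, ∀ (k : ℕ) (r : ℝ) (x y : ((↥(pbox (Mc B)) × Fin (3 + 1)) → ℝ)), ((hb n) B) k (r • x + y) = r • ((hb n) B) k x + ((hb n) B) k y := fun n B k r' x' y' => hb_linear (R := Roots.ctr Lc) (n := n) (M := Mc B) (yN := fun a : ↥(pbox (Mc B)) × Fin (3 + 1) => (a.1 : Site (3 + 1))) (μN := fun a : ↥(pbox (Mc B)) × Fin (3 + 1) => a.2) (hv := (hv n) B) (hbF := (hb n) B) (hhbF := (hhbe n) B) (fun r' x' y' => by rw [(hhv n) B, (hhv n) B, (hhv n) B]; exact nestedColumn_linear _ _ r' x' y') k r' x' y'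
  have hbtop : ∀ n : ℕ, ∀ B : ℕ, ∀ v, ((hb n) B) (n + 1) v = ((hv n) B) v := fun n B v => hb_top (R := Roots.ctr Lc) (n := n) (M := Mc B) (yN := fun a : ↥(pbox (Mc B)) × Fin (3 + 1) => (a.1 : Site (3 + 1))) (μN := fun a : ↥(pbox (Mc B)) × Fin (3 + 1) => a.2) (hv := (hv n) B) (hbF := (hb n) B) (hhbF := (hhbe n) B) v
  have K1 : ∀ n : ℕ, ∀ B : ℕ, ∀ v : ((↥(pbox (Mc B)) × Fin (3 + 1)) → ℝ), ∀ u : ↥(pbox (towerTorus Lc (fine Lc (Mc B)) (n + 1))) × Fin (3 + 1), (c n) * ((perF (towerTorus Lc (fine Lc (Mc B)) (n + 1)) (bhKStepAt 3 (toSite rH) Lc 0)).submatrix (fun b : ↥(pbox (towerTorus Lc (fine Lc (Mc B)) (n + 1))) × Fin (3 + 1) => ((b.1, Sum.inl b.2) : Idx (towerTorus Lc (fine Lc (Mc B)) (n + 1)) (Fib 3))) (fun b : ↥(pbox (towerTorus Lc (fine Lc (Mc B)) (n + 1))) × Fin (3 + 1) => ((b.1, Sum.inl b.2) : Idx (towerTorus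 Lc (fine Lc (Mc B)) (n + 1)) (Fib 3)))).mulVec (((hb n) B) (n + 1) v) u = (w n) (n + 1) * ∑ ā : ↥(pbox (towerTorus Lc (fine Lc (Mc B)) (n + 1))) × Fin (3 + 1), ((hb n) B) (n + 1) v ā * ∑ μ : Fin (3 + 1), ∑' y : Site (3 + 1), (∑' m : Site (3 + 1), (cf n) B (n + 1) μ (translate (towerTorus Lc (Mc B) (n + 1)) y m) ā.2 (ā.1 : Site (3 + 1))) * symLinKerAt (toSite (ctrOff (3 + 1) Lc)) Lc μ y (u.2, (u.1 : Site (3 + 1))) := fun n B v u => by rw [hb_top (R := Roots.ctr Lc) (n := n) (M := Mc B) (yN := fun a : ↥(pbox (Mc B)) × Fin (3 + 1) => (a.1 : Site (3 + 1))) (μN := fun a : ↥(pbox (Mc B)) × Fin (3 + 1) => a.2) (hv := (hv n) B) (hbF := (hb n) B) (hhbF := (hhbe n) B) v]; exact K1_row_top (R := Roots.ctr Lc) (n := n) (M := Mc B) (T' := towerTorus Lc (Mc B) (n + 1)) (hT' := fun i => towerTorus_fine_apply_eq (Mc B) (n + 1) i) (hrH := hrH) (ρH := toSite rH) (hρH :=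 rfl) (c := c n) (w₁ := (w n) (n + 1)) (hw₁ := w_top n (c n) (κ n) (w n) (hκe n) (hwe n)) (cf₁ := (cf n) B (n + 1)) (hcf₁ := fun κ₁ s' κ' x => by rw [(hcfe n) B, if_pos rfl]) (yN := fun a : ↥(pbox (Mc B)) × Fin (3 + 1) => (a.1 : Site (3 + 1))) (μN := fun a : ↥(pbox (Mc B)) × Fin (3 + 1) => a.2) (hv := (hv n) B) (hhvl := (fun r' x' y' => by rw [(hhv n) B, (hhv n) B, (hhv n) B]; exact nestedColumn_linear _ _ r' x' y')) (lam := fun a => ((lv n) B) (Pi.single a 1)) (hJW := (hJW n) B) (hfold := (hfold n) B) v u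
  have hlink : ∀ n : ℕ, ∀ B : ℕ, ∀ v : ((↥(pbox (Mc B)) × Fin (3 + 1)) → ℝ), ∀ k, k < n + 1 → ∀ a : ↥(pbox (towerTorus Lc (fine Lc (Mc B)) k)) × Fin (3 + 1), (w n) k * (κ n) k * (∑ ā : ↥(pbox (towerTorus Lc (fine Lc (Mc B)) k)) × Fin (3 + 1), ((hb n) B) k v ā * ∑ μ : Fin (3 + 1), ∑' y : Site (3 + 1), (∑' m : Site (3 + 1), (cf n) B k μ (translate (towerTorus Lc (Mc B) k) y m) ā.2 (ā.1 : Site (3 + 1))) * symLinKerAt (toSite (ctrOff (3 + 1) Lc)) Lc μ y (a.2, (a.1 : Site (3 + 1)))) = (w n) (k + 1) * (κ n) (k + 1) / (stepScale 3 Lc (n + 1 - (k + 1)) * (Lc : ℝ) ^ (3 + 1)) * ∑ ā : ↥(pbox (towerTorus Lc (fine Lc (Mc B)) (k + 1))) × Fin (3 + 1), ((hb n) B) (k + 1) v ā * ∑' m : Site (3 + 1), (cf n) B (k + 1) a.2 (translate (towerTorus Lc (fine Lc (Mc B)) k) (a.1 : Site (3 + 1)) m) ā.2 (ā.1 : Site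 (3 + 1)) := fun n B v k hk a => hlink_row (R := Roots.ctr Lc) (n := n) (M := Mc B) (yN := fun a : ↥(pbox (Mc B)) × Fin (3 + 1) => (a.1 : Site (3 + 1))) (μN := fun a : ↥(pbox (Mc B)) × Fin (3 + 1) => a.2) (hv := (hv n) B) (cfF := (cf n) B) (hcfF := (hcfe n) B) (hbF := (hb n) B) (hhbF := (hhbe n) B) (c := c n) (κF := κ n) (wF := w n) (hκF := hκe n) (hwF := hwe n) (T' := towerTorus Lc (Mc B) (n + 1)) (hT' := fun i => towerTorus_fine_apply_eq (Mc B) (n + 1) i) (hhvl := (fun r' x' y' => by rw [(hhv n) B, (hhv n) B, (hhv n) B]; exact nestedColumn_linear _ _ r' x' y')) (lam := fun a => ((lv n) B) (Pi.single a 1)) (hJW := (hJW n) B) (hfold := (hfold n) B) v k hk a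
  have hXbfl : ∀ n : ℕ, ∀ B : ℕ, ∀ (r : ℝ) (x y : ((↥(pbox (Mc B)) × Fin (3 + 1)) → ℝ)), ((Xbf n) B) (r • x + y) = r • ((Xbf n) B) x + ((Xbf n) B) y := fun n B => Xbf_linear_of_pin (c n) ((lv n) B) ((hlv n) B) (fun a : ↥(pbox (Mc B)) × Fin (3 + 1) => itRoot Lc (Mc B) (fun _ : ℕ => ctrOff (3 + 1) Lc) (fun _ => (ctrOff_mem_box (d := 3 + 1) (Nat.one_le_iff_ne_zero.mpr (NeZero.ne Lc)))) (n + 1 + 1) a.1) ((Xbf n) B) ((hXbf n) B)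
  have hH₂l : ∀ n : ℕ, ∀ B : ℕ, ∀ (r : ℝ) (x y z : ((↥(pbox (Mc B)) × Fin (3 + 1)) → ℝ)), ((H₂f n) B) (r • x + y) z = r • ((H₂f n) B) x z + ((H₂f n) B) y z := fun n B => H2f_linear_left (M := Mc B) (n := n) (c := c n) (hv := (hv n) B) (hhvl := (fun r' x' y' => by rw [(hhv n) B, (hhv n) B, (hhv n) B]; exact nestedColumn_linear _ _ r' x' y')) (T₂ := (T₂ n) B) (hm := (hm n) B) (hml := (hml n) B) (M₂ := (M₂ n) B) (cM₂ := cM₂ n) (H₂f := (H₂f n) B) (hH₂f := (hH₂f n) B)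
  have hH₂r : ∀ n : ℕ, ∀ B : ℕ, ∀ (r : ℝ) (x y z : ((↥(pbox (Mc B)) × Fin (3 + 1)) → ℝ)), ((H₂f n) B) z (r • x + y) = r • ((H₂f n) B) z x + ((H₂f n) B) z y := fun n B => H2f_linear_right (M := Mc B) (n := n) (c := c n) (hv := (hv n) B) (hhvl := (fun r' x' y' => by rw [(hhv n) B, (hhv n) B, (hhv n) B]; exact nestedColumn_linear _ _ r' x' y')) (T₂ := (T₂ n) B) (hm := (hm n) B) (hml := (hml n) B) (M₂ := (M₂ n) B) (cM₂ := cM₂ n) (H₂f := (H₂f n) B) (hH₂f := (hH₂f n) B)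
  have hH₂t : ∀ n : ℕ, ∀ B : ℕ, ∀ v, (((H₂f n) B) v v)ᵀ = ((H₂f n) B) v v := fun n B => H2f_transpose (M := Mc B) (n := n) (c := c n) (Pn := Pn) (hv := (hv n) B) (T₂ := (T₂ n) B) (hT₂ := (hT₂ n) B) (hm := (hm n) B) (M₂ := (M₂ n) B) (hM₂ := (hM₂ n) B) (cM₂ := cM₂ n) (H₂f := (H₂f n) B) (hH₂f := (hH₂f n) B)
  have hfNi : ∀ n : ℕ, ∀ B : ℕ, Function.Injective ((fN n) B) := fun n B => by rw [show (fN n) B = _ from funext ((hfN n) B)]; exact towerSlot_injective (Mc B) n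
  have hmN : ∀ n : ℕ, ∀ B : ℕ, ∀ a : (↥(pbox (Mc B)) × Fin (3 + 1)), ∃ m : Fin (3 + 1), ((fN n) B a).2 = Sum.inr m := fun n B a => by rw [(hfN n) B a]; exact ⟨a.2, rfl⟩
  have hcN : ∀ n : ℕ, ∀ B : ℕ, ∀ (s : ↥(pbox (towerTorus Lc (fine Lc (Mc B)) (n + 1)))) (m : Fin (3 + 1)), ((s, Sum.inr m) : Idx (towerTorus Lc (fine Lc (Mc B)) (n + 1)) (Fib 3)) ∈ Set.range ((fN n) B) ↔ Torus.proj (Lc ^ (n + 1 + 1)) (s : Site (3 + 1)) = 0 := fun n B s m => by rw [show (fN n) B = _ from funext ((hfN n) B)]; exact towerSlot_range (Mc B) n s m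
  have hHN₁ : ∀ (n : ℕ) (μ : Fin (3 + 1)) (y : Fin (3 + 1) → ℤ), ∀ B : ℕ, (H'₁f n) B ((dv n) B (μ, y)) = (perF (towerTorus Lc (fine Lc (Mc B)) (n + 1)) (dper (towerTorus Lc (fine Lc (Mc B)) (n + 1)) ((VN (Roots.ctr Lc) Pn (n + 1)) μ y))).submatrix (fun b : (↥(pbox (towerTorus Lc (fine Lc (Mc B)) (n + 1))) × Fin (3 + 1)) => ((b.1, Sum.inl b.2) : Idx (towerTorus Lc (fine Lc (Mc B)) (n + 1)) (Fib 3))) (fun b : (↥(pbox (towerTorus Lc (fine Lc (Mc B)) (n + 1))) × Fin (3 + 1)) => ((b.1, Sum.inl b.2) : Idx (towerTorus Lc (fine Lc (Mc B)) (n + 1)) (Fib 3))) := fun n μ y B => hHN1_family_of_road_data (n := n) (M := Mc B) (P := Pn) (N₁ := N) (lev := fun i : ℕ => n + 1 - i) (hlev := fun i _ => rfl) (rs := fun _ : ℕ => ctrOff (3 + 1) Lc) (c := c n) (hv := (hv n) B) (hhvl := (fun r' x' y' => by rw [(hhv n) B, (hhv n) B, (hhv n) B]; exact nestedColumn_linear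 _ _ r' x' y')) (lv := (lv n) B) (hlv := (hlv n) B) (hJW := (hJW n) B) (r := r n) (hr := hr n) (dv := (dv n) B) (hdv := (hdv n) B) (cfF := (cf n) B) (hcfF := (hcfe n) B) (hbF := (hb n) B) (hhbF := (hhbe n) B) (κF := κ n) (wF := w n) (hκF := hκe n) (hwF := hwe n) (T' := towerTorus Lc (Mc B) (n + 1)) (hT' := fun i => towerTorus_fine_apply_eq (Mc B) (n + 1) i) (hfold := (hfold n) B) (hcΛ := hcΛ n) (hH₀ := by rw [(hH₀ n) B, Nat.sub_self]) (hLc := hLc2) (H₁f := (H₁f n) B) (H'₁f := (H'₁f n) B) (hH₁f := (hH₁f n) B) (hH'₁f := (hH'₁f n) B) μ y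
  have hQN₁ : ∀ (n : ℕ) (μ : Fin (3 + 1)) (y : Fin (3 + 1) → ℤ), ∀ B : ℕ, (𝔔'₁f n) B ((dv n) B (μ, y)) = (perF (towerTorus Lc (fine Lc (Mc B)) (n + 1)) (dper (towerTorus Lc (fine Lc (Mc B)) (n + 1)) ((VN (Roots.ctr Lc) Pn (n + 1)) μ y))).submatrix ((fN n) B) (fun b : (↥(pbox (towerTorus Lc (fine Lc (Mc B)) (n + 1))) × Fin (3 + 1)) => ((b.1, Sum.inl b.2) : Idx (towerTorus Lc (fine Lc (Mc B)) (n + 1)) (Fib 3))) := fun n μ y B => hQN1_family_of_road_data (n := n) (M := Mc B) (P := Pn) (c := c n) (hc := (ctrOff_mem_box (d := 3 + 1) (Nat.one_le_iff_ne_zero.mpr (NeZero.ne Lc)))) (hv := (hv n) B) (hhvl := (fun r' x' y' => by rw [(hhv n) B, (hhv n) B, (hhv n) B]; exact nestedColumn_linear _ _ r' x' y')) (lv := (lv n) B) (hlv := (hlv n) B) (hJW := (hJW n) B) (r := r n) (hr := hr n) (dv := (dv n) B) (hdv := (hdv n) B) (Q₁₀ := (Q₁₀ n) B) (hQ₁₀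 := (hQ₁₀ n) B) (Q₂₀ := (Q₂₀ n) B) (hQ₂₀ := (hQ₂₀ n) B) (Q₁₁f := (Q₁₁f n) B) (hQ₁₁f := (hQ₁₁f n) B) (Q₂₁f := (Q₂₁f n) B) (hQ₂₁f := (hQ₂₁f n) B) (𝔔₀ := (𝔔₀ n) B) (h𝔔₀ := (h𝔔₀ n) B) (𝔔₁f := (𝔔₁f n) B) (h𝔔₁ := (h𝔔₁ n) B) (Xbf := (Xbf n) B) (hXbf := (hXbf n) B) (𝔔'₁f := (𝔔'₁f n) B) (h𝔔'₁f := (h𝔔'₁f n) B) (fN := (fN n) B) (hfN := (hfN n) B) (hcVH := hcVH n) μ y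
  have hHN₂ : ∀ (n : ℕ) (μ : Fin (3 + 1)) (y : Fin (3 + 1) → ℤ) (ν : Fin (3 + 1)) (y' : Fin (3 + 1) → ℤ), ∀ B : ℕ, (1 / 2 : ℝ) • ((H'₂f n) B ((dv n) B (μ, y)) ((dv n) B (ν, y')) + (H'₂f n) B ((dv n) B (ν, y')) ((dv n) B (μ, y))) = (perF (towerTorus Lc (fine Lc (Mc B)) (n + 1)) (dper (towerTorus Lc (fine Lc (Mc B)) (n + 1)) (fun x w a b => ∑' e : Site (3 + 1), ((1 / 2 : ℝ) • (WN (Roots.ctr Lc) Pn (n + 1) μ y ν (translate (Mc B) y' e) + sgnK (trK (WN (Roots.ctr Lc) Pn (n + 1) μ y ν (translate (Mc B) y' e))))) x w a b))).submatrix (fun b : (↥(pbox (towerTorus Lc (fine Lc (Mc B)) (n + 1))) × Fin (3 + 1)) => ((b.1, Sum.inl b.2) : Idx (towerTorus Lc (fine Lc (Mc B)) (n + 1)) (Fib 3))) (fun b : (↥(pbox (towerTorus Lc (fine Lc (Mc B)) (n + 1))) × Fin (3 + 1)) => ((b.1, Sum.inl b.2) : Idx (towerTorus Lc (fine Lc (Mc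 B)) (n + 1)) (Fib 3))) := fun n μ y ν y' B => hHN2_family_of_locks_of_junctions (M := Mc B) (n := n) (c := c n) (Pn := Pn) (hv := (hv n) B) (hhvl := (fun r' x' y' => by rw [(hhv n) B, (hhv n) B, (hhv n) B]; exact nestedColumn_linear _ _ r' x' y')) (lv := (lv n) B) (hlv := (hlv n) B) (hJW := (hJW n) B) (hH₀ := by rw [(hH₀ n) B, Nat.sub_self]) (T₂ := (T₂ n) B) (hT₂ := (hT₂ n) B) (hX₂ := fun b lam => torus_T2evenPair_pureGauge_snd_fun (M := towerTorus Lc (fine Lc (Mc B)) (n + 1)) (N := N) hN (T₂ := (T₂ n) B) (fun b₁ b₂ => by rw [(hT₂ n) B b₁ b₂, hTW n]) b lam) (Λ₁ := fun v => ((w n) (n + 1) • ∑ ā : ↥(pbox (towerTorus Lc (fine Lc (Mc B)) (n + 1))) × Fin (3 + 1), ((hv n) B) v ā • (perF (towerTorus Lc (fine Lc (Mc B)) (n + 1)) (dper (towerTorus Lc (fine Lc (Mc B)) (n + 1)) (SLam N ((cf n) B (n + 1)) (fun μ y => symHessFFAt (toSite (ctrOff (3 + 1) Lc)) Lc μ y)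 ā.2 (ā.1 : Site (3 + 1))))).submatrix (fun b : ↥(pbox (towerTorus Lc (fine Lc (Mc B)) (n + 1))) × Fin (3 + 1) => ((b.1, Sum.inl b.2) : Idx (towerTorus Lc (fine Lc (Mc B)) (n + 1)) (Fib 3))) (fun b : ↥(pbox (towerTorus Lc (fine Lc (Mc B)) (n + 1))) × Fin (3 + 1) => ((b.1, Sum.inl b.2) : Idx (towerTorus Lc (fine Lc (Mc B)) (n + 1)) (Fib 3))) + compSumSym Lc (onTowerFamily Lc (fine Lc (Mc B)) (fun k => (w n) k • ∑ ā : ↥(pbox (towerTorus Lc (fine Lc (Mc B)) k)) × Fin (3 + 1), ((hb n) B) k v ā • (perF (towerTorus Lc (fine Lc (Mc B)) k) (dper (towerTorus Lc (fine Lc (Mc B)) k) (SLam N ((cf n) B k) (fun μ y => symHessFFAt (toSite (ctrOff (3 + 1) Lc)) Lc μ y) ā.2 (ā.1 : Site (3 + 1))))).submatrix (fun b : ↥(pbox (towerTorus Lc (fine Lc (Mc B)) k)) × Fin (3 + 1) => ((b.1, Sum.inl b.2) : Idx (towerTorus Lc (fine Lc (Mc B)) k) (Fib 3))) (fun b : ↥(pbox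 (towerTorus Lc (fine Lc (Mc B)) k)) × Fin (3 + 1) => ((b.1, Sum.inl b.2) : Idx (towerTorus Lc (fine Lc (Mc B)) k) (Fib 3))))) (fine Lc (Mc B)) (fun i : ℕ => n + 1 - i) (fun _ : ℕ => ctrOff (3 + 1) Lc) (n + 1))) (H₁f := (H₁f n) B) (hH₁ := (fun v => by rw [(hH₁f n) B v, hb_top (R := Roots.ctr Lc) (n := n) (M := Mc B) (yN := fun a : ↥(pbox (Mc B)) × Fin (3 + 1) => (a.1 : Site (3 + 1))) (μN := fun a : ↥(pbox (Mc B)) × Fin (3 + 1) => a.2) (hv := (hv n) B) (hbF := (hb n) B) (hhbF := (hhbe n) B) v, add_assoc])) (Λ₂ := fun v v' => (cM₂ n) • ∑ b : ↥(pbox (towerTorus Lc (fine Lc (Mc B)) (n + 1))) × Fin (3 + 1), ∑ β : ↥(pbox (Mc B)) × Fin (3 + 1), (((hv n) B) v b * ((hm n) B) v' β + ((hv n) B) v' b * ((hm n) B) v β) • ((M₂ n) B) b β) (H₂f := (H₂f n) B) (hH₂ := (fun v v' => H2f_half_symm_eq (M := Mc B) (n := n) (c := c n) (Pn := Pn) (hv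 := (hv n) B) (T₂ := (T₂ n) B) (hT₂ := (hT₂ n) B) (hm := (hm n) B) (M₂ := (M₂ n) B) (cM₂ := cM₂ n) (H₂f := (H₂f n) B) (hH₂f := (hH₂f n) B) v v')) (H'₂f := (H'₂f n) B) (hH'₂f := (hH'₂f n) B) (r := r n) (hr := hr n) (dv := (dv n) B) (hdv := (hdv n) B) (hcE₂ := hcE₂ n) (hJΛ₂ := fun a a' p q α β => hJΛ2_of_mixedLock_of_mixedGauge (M := Mc B) (n := n) (c := c n) (Pn := Pn) (yN := fun a₁ : ↥(pbox (Mc B)) × Fin (3 + 1) => (a₁.1 : Site (3 + 1))) (μN := fun a₁ : ↥(pbox (Mc B)) × Fin (3 + 1) => a₁.2) (hv := (hv n) B) (hhvl := (fun r' x' y' => by rw [(hhv n) B, (hhv n) B, (hhv n) B]; exact nestedColumn_linear _ _ r' x' y')) (lv := (lv n) B) (hlv := (hlv n) B) (hJW := (hJW n) B) (hm := (hm n) B) (hml := (hml n) B) (hJM := (hJM n) B) (M₂ := (M₂ n) B) (hM₂ := (hM₂ n) B) (Λ₁ := fun v => ((w n) (n + 1) • ∑ ā : ↥(pbox (towerTorus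 Lc (fine Lc (Mc B)) (n + 1))) × Fin (3 + 1), ((hv n) B) v ā • (perF (towerTorus Lc (fine Lc (Mc B)) (n + 1)) (dper (towerTorus Lc (fine Lc (Mc B)) (n + 1)) (SLam N ((cf n) B (n + 1)) (fun μ y => symHessFFAt (toSite (ctrOff (3 + 1) Lc)) Lc μ y) ā.2 (ā.1 : Site (3 + 1))))).submatrix (fun b : ↥(pbox (towerTorus Lc (fine Lc (Mc B)) (n + 1))) × Fin (3 + 1) => ((b.1, Sum.inl b.2) : Idx (towerTorus Lc (fine Lc (Mc B)) (n + 1)) (Fib 3))) (fun b : ↥(pbox (towerTorus Lc (fine Lc (Mc B)) (n + 1))) × Fin (3 + 1) => ((b.1, Sum.inl b.2) : Idx (towerTorus Lc (fine Lc (Mc B)) (n + 1)) (Fib 3))) + compSumSym Lc (onTowerFamily Lc (fine Lc (Mc B)) (fun k => (w n) k • ∑ ā : ↥(pbox (towerTorus Lc (fine Lc (Mc B)) k)) × Fin (3 + 1), ((hb n) B) k v ā • (perF (towerTorus Lc (fine Lc (Mc B)) k) (dper (towerTorus Lc (fine Lc (Mc B)) k) (SLam N ((cf n) B k) (fun μ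 y => symHessFFAt (toSite (ctrOff (3 + 1) Lc)) Lc μ y) ā.2 (ā.1 : Site (3 + 1))))).submatrix (fun b : ↥(pbox (towerTorus Lc (fine Lc (Mc B)) k)) × Fin (3 + 1) => ((b.1, Sum.inl b.2) : Idx (towerTorus Lc (fine Lc (Mc B)) k) (Fib 3))) (fun b : ↥(pbox (towerTorus Lc (fine Lc (Mc B)) k)) × Fin (3 + 1) => ((b.1, Sum.inl b.2) : Idx (towerTorus Lc (fine Lc (Mc B)) k) (Fib 3))))) (fine Lc (Mc B)) (fun i : ℕ => n + 1 - i) (fun _ : ℕ => ctrOff (3 + 1) Lc) (n + 1))) (Λ₂ := fun v v' => (cM₂ n) • ∑ b : ↥(pbox (towerTorus Lc (fine Lc (Mc B)) (n + 1))) × Fin (3 + 1), ∑ β : ↥(pbox (Mc B)) × Fin (3 + 1), (((hv n) B) v b * ((hm n) B) v' β + ((hv n) B) v' b * ((hm n) B) v β) • ((M₂ n) B) b β) (cM₂ := cM₂ n) (hΛ₂ := fun v v' => rfl) (r := r n) (a := a) (a' := a') (hcM₂ := hcM₂ n) (hJΛ₂' := hJΛ2'_of_wardRow (M := Mc B) (n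 := n) (c := c n) (Pn := Pn) (yN := fun a₁ : ↥(pbox (Mc B)) × Fin (3 + 1) => (a₁.1 : Site (3 + 1))) (μN := fun a₁ : ↥(pbox (Mc B)) × Fin (3 + 1) => a₁.2) (lv := (lv n) B) (Λ₁ := fun v => ((w n) (n + 1) • ∑ ā : ↥(pbox (towerTorus Lc (fine Lc (Mc B)) (n + 1))) × Fin (3 + 1), ((hv n) B) v ā • (perF (towerTorus Lc (fine Lc (Mc B)) (n + 1)) (dper (towerTorus Lc (fine Lc (Mc B)) (n + 1)) (SLam N ((cf n) B (n + 1)) (fun μ y => symHessFFAt (toSite (ctrOff (3 + 1) Lc)) Lc μ y) ā.2 (ā.1 : Site (3 + 1))))).submatrix (fun b : ↥(pbox (towerTorus Lc (fine Lc (Mc B)) (n + 1))) × Fin (3 + 1) => ((b.1, Sum.inl b.2) : Idx (towerTorus Lc (fine Lc (Mc B)) (n + 1)) (Fib 3))) (fun b : ↥(pbox (towerTorus Lc (fine Lc (Mc B)) (n + 1))) × Fin (3 + 1) => ((b.1, Sum.inl b.2) : Idx (towerTorus Lc (fine Lc (Mc B)) (n + 1)) (Fib 3))) + compSumSym Lc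 (onTowerFamily Lc (fine Lc (Mc B)) (fun k => (w n) k • ∑ ā : ↥(pbox (towerTorus Lc (fine Lc (Mc B)) k)) × Fin (3 + 1), ((hb n) B) k v ā • (perF (towerTorus Lc (fine Lc (Mc B)) k) (dper (towerTorus Lc (fine Lc (Mc B)) k) (SLam N ((cf n) B k) (fun μ y => symHessFFAt (toSite (ctrOff (3 + 1) Lc)) Lc μ y) ā.2 (ā.1 : Site (3 + 1))))).submatrix (fun b : ↥(pbox (towerTorus Lc (fine Lc (Mc B)) k)) × Fin (3 + 1) => ((b.1, Sum.inl b.2) : Idx (towerTorus Lc (fine Lc (Mc B)) k) (Fib 3))) (fun b : ↥(pbox (towerTorus Lc (fine Lc (Mc B)) k)) × Fin (3 + 1) => ((b.1, Sum.inl b.2) : Idx (towerTorus Lc (fine Lc (Mc B)) k) (Fib 3))))) (fine Lc (Mc B)) (fun i : ℕ => n + 1 - i) (fun _ : ℕ => ctrOff (3 + 1) Lc) (n + 1))) (M₂ := (M₂ n) B) (cM₂ := cM₂ n) (r := r n) (a := a) (a' := a') (cΛS := Pn.cΛ (n + 1 + 1)) (κ₂ := κ₂ n) (hΛS := fun a₀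 => hΛS_of_road_data (n := n) (M := Mc B) (P := Pn) (N₁ := N) (lev := fun i : ℕ => n + 1 - i) (hlev := fun i _ => rfl) (rs := fun _ : ℕ => ctrOff (3 + 1) Lc) (yN := fun a₁ : ↥(pbox (Mc B)) × Fin (3 + 1) => (a₁.1 : Site (3 + 1))) (μN := fun a₁ : ↥(pbox (Mc B)) × Fin (3 + 1) => a₁.2) (hv := (hv n) B) (cfF := (cf n) B) (hcfF := (hcfe n) B) (hbF := (hb n) B) (hhbF := (hhbe n) B) (c := c n) (κF := κ n) (wF := w n) (hκF := hκe n) (hwF := hwe n) (T' := towerTorus Lc (Mc B) (n + 1)) (hT' := fun i => towerTorus_fine_apply_eq (Mc B) (n + 1) i) (hhvl := (fun r' x' y' => by rw [(hhv n) B, (hhv n) B, (hhv n) B]; exact nestedColumn_linear _ _ r' x' y')) (lv := (lv n) B) (hJW := (hJW n) B) (hfold := (hfold n) B) (r := r n) (hr := hr n) (hcΛ := hcΛ n) (a := a₀) (hLc := hLc2)) (Rs := (Rs n) B) (hK2b := (hK2b n) B) (hL := hLk n) (hR₂ := (hR₂ n) B a a')) p q α β) μ y ν y'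
  have hQN₂ : ∀ (n : ℕ) (μ : Fin (3 + 1)) (y : Fin (3 + 1) → ℤ) (ν : Fin (3 + 1)) (y' : Fin (3 + 1) → ℤ), ∀ B : ℕ, (1 / 2 : ℝ) • ((𝔔'₂f n) B ((dv n) B (μ, y)) ((dv n) B (ν, y')) + (𝔔'₂f n) B ((dv n) B (ν, y')) ((dv n) B (μ, y))) = (perF (towerTorus Lc (fine Lc (Mc B)) (n + 1)) (dper (towerTorus Lc (fine Lc (Mc B)) (n + 1)) (fun x w a b => ∑' e : Site (3 + 1), ((1 / 2 : ℝ) • (WN (Roots.ctr Lc) Pn (n + 1) μ y ν (translate (Mc B) y' e) + sgnK (trK (WN (Roots.ctr Lc) Pn (n + 1) μ y ν (translate (Mc B) y' e))))) x w a b))).submatrix ((fN n) B) (fun b : (↥(pbox (towerTorus Lc (fine Lc (Mc B)) (n + 1))) × Fin (3 + 1)) => ((b.1, Sum.inl b.2) : Idx (towerTorus Lc (fine Lc (Mc B)) (n + 1)) (Fib 3))) := fun n μ y ν y' B => hQN2_family_of_lock (M := Mc B) (n := n) (c := c n) (Pn := Pn) (fN := (fN n) B) (hfN := (hfN n) B)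 (hc := (ctrOff_mem_box (d := 3 + 1) (Nat.one_le_iff_ne_zero.mpr (NeZero.ne Lc)))) (hv := (hv n) B) (hhvl := (fun r' x' y' => by rw [(hhv n) B, (hhv n) B, (hhv n) B]; exact nestedColumn_linear _ _ r' x' y')) (lv := (lv n) B) (hlv := (hlv n) B) (hJW := (hJW n) B) (𝔔₀ := (𝔔₀ n) B) (h𝔔₀' := (by rw [← (h𝔔₀ n) B, (hQ₂₀ n) B, (hQ₁₀ n) B]; exact nestedRowsSym_eq_compRowsSym (Lc := Lc) (n := n + 1) (M := Mc B) (lev := fun i : ℕ => n + 1 - (i - 1)) (rs := fun _ : ℕ => ctrOff (3 + 1) Lc))) (𝔔₁f := (𝔔₁f n) B) (h𝔔₁' := (fun v => by rw [← (h𝔔₁ n) B v, (hQ₂₁f n) B v, (hQ₁₀ n) B, (hQ₂₀ n) B, (hQ₁₁f n) B v]; exact nestedQ₁Sym_eq_smul_compIns₁Sym (Lc := Lc) (n := n + 1) (M := Mc B) (lev := fun i : ℕ => n + 1 - (i - 1)) (rs := fun _ : ℕ => ctrOff (3 + 1) Lc) (c := c n) (w := ((hv n) B) v))) (𝔔₂f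 := (𝔔₂f n) B) (h𝔔₂' := (fun v v' => by rw [← (h𝔔₂ n) B v v', ← (h𝔔₂ n) B v' v, (hQ₂₁f n) B v, (hQ₂₁f n) B v', (hQ₂₂f n) B v v', (hQ₂₂f n) B v' v, (hQ₁₀ n) B, (hQ₂₀ n) B, (hQ₁₁f n) B v, (hQ₁₁f n) B v', (hQ₁₂f n) B v v', (hQ₁₂f n) B v' v]; exact nestedQ₂Sym_symm_eq_smul_compIns₂₂Sym (Lc := Lc) (n := n + 1) (M := Mc B) (lev := fun i : ℕ => n + 1 - (i - 1)) (rs := fun _ : ℕ => ctrOff (3 + 1) Lc) (hc := (ctrOff_mem_box (d := 3 + 1) (Nat.one_le_iff_ne_zero.mpr (NeZero.ne Lc)))) (c := c n) (Q₂₁ := fun w => ∑ a' : (↥(pbox (fine Lc (Mc B))) × Fin (3 + 1)), (((c n) * (((Lc : ℝ) ^ (3 + 1) * stepScale 3 Lc ((n + 1 - 0))) * (∏ i ∈ range (n + 1), (stepScale 3 Lc ((n + 1 - (i + 1))) * ((box (3 + 1) Lc).card : ℝ)))⁻¹)) * (compRowsSym Lc (fine Lc (Mc B)) (fun i : ℕ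 => n + 1 - i) (fun _ : ℕ => ctrOff (3 + 1) Lc) (n + 1) *ᵥ w) a') • (perF (fine Lc (Mc B)) (dper (fine Lc (Mc B)) (symVhSAt (ctr (3 + 1) Lc) 3 Lc rfl a'.2 (a'.1 : Site (3 + 1))))).submatrix (fun k : (↥(pbox (Mc B)) × Fin (3 + 1)) => (((coarsePt (Mc B) Lc k.1, Sum.inr (k.2)) : Idx (fine Lc (Mc B)) (Fib 3)))) (fun b : (↥(pbox (fine Lc (Mc B))) × Fin (3 + 1)) => ((b.1, Sum.inl b.2) : Idx (fine Lc (Mc B)) (Fib 3)))) (hQ₂₁ := fun w => rfl) (Q₂₂ := fun w w' => ((Lc : ℝ) ^ (3 + 1) * stepScale 3 Lc ((n + 1 - 0)))⁻¹ • ∑ b : (↥(pbox (fine Lc (Mc B))) × Fin (3 + 1)), ∑ b' : (↥(pbox (fine Lc (Mc B))) × Fin (3 + 1)), ((((c n) * (((Lc : ℝ) ^ (3 + 1) * stepScale 3 Lc ((n + 1 - 0))) * (∏ i ∈ range (n + 1), (stepScale 3 Lc ((n + 1 - (i + 1))) * ((box (3 + 1) Lc).card : ℝ)))⁻¹)) *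 (compRowsSym Lc (fine Lc (Mc B)) (fun i : ℕ => n + 1 - i) (fun _ : ℕ => ctrOff (3 + 1) Lc) (n + 1) *ᵥ w) b) * (((c n) * (((Lc : ℝ) ^ (3 + 1) * stepScale 3 Lc ((n + 1 - 0))) * (∏ i ∈ range (n + 1), (stepScale 3 Lc ((n + 1 - (i + 1))) * ((box (3 + 1) Lc).card : ℝ)))⁻¹)) * (compRowsSym Lc (fine Lc (Mc B)) (fun i : ℕ => n + 1 - i) (fun _ : ℕ => ctrOff (3 + 1) Lc) (n + 1) *ᵥ w') b')) • (perF (fine Lc (Mc B)) (dper (fine Lc (Mc B)) (fun x z a e => ∑' m : Site (3 + 1), (1 / 2 : ℝ) * (symVh₂SAt (ctr (3 + 1) Lc) Lc b.2 (b.1 : Site (3 + 1)) b'.2 (translate (fine Lc (Mc B)) (b'.1 : Site (3 + 1)) m) x z a e + symVh₂SAt (ctr (3 + 1) Lc) Lc b'.2 (translate (fine Lc (Mc B)) (b'.1 : Site (3 + 1)) m) b.2 (b.1 : Site (3 + 1)) x z a e)))).submatrix (fun k : (↥(pbox (Mc B)) × Fin (3 + 1)) => (((coarsePt (Mc B) Lc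 k.1, Sum.inr (k.2)) : Idx (fine Lc (Mc B)) (Fib 3)))) (fun b : (↥(pbox (fine Lc (Mc B))) × Fin (3 + 1)) => ((b.1, Sum.inl b.2) : Idx (fine Lc (Mc B)) (Fib 3)))) (hQ₂₂ := fun w w' => rfl) (w := ((hv n) B) v) (w' := ((hv n) B) v'))) (Xbf := (Xbf n) B) (hXbf := (hXbf n) B) (𝔔'₂f := (𝔔'₂f n) B) (h𝔔'₂f := (h𝔔'₂f n) B) (r := r n) (dv := (dv n) B) (hdv := (hdv n) B) (hcB := hcB n) μ y ν y'
  have hL0 : 0 < Lc := Nat.pos_of_ne_zero (NeZero.ne Lc)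
  have hL1 : 1 ≤ Lc := hL0
  refine d1Tel_JcComp_ctr_nested_of_hessKer_laws_wStep hLc N cΛ cB Pn AF 𝒱F 𝒲F (fun j => GcombSh (d := 3) Lc j) 𝒱G 𝒲G ?_ hF₁ htr hG hT0 hT1
  intro j hj μ ν z
  obtain ⟨n, rfl⟩ : ∃ n, j = n + 1 := ⟨j - 1, by omega⟩
  obtain ⟨δA, CA, hδA, -, hA⟩ := decays_compChart (d := 3) hL1 (rc := (Roots.ctr Lc).rc) (fun _ => ctrOff_mem_box (d := 3 + 1) hL1) (n + 1 + 1)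
    (s := (Roots.ctr Lc).s (n + 1 + 1)) (ctrOff_mem_box (d := 3 + 1) (Nat.one_le_pow _ _ hL1))
  have key := hessKer_law_tower_namedC (Lc := Lc) (M' := fun B => fine Lc (Mc B)) (lev := fun i : ℕ => n + 1 - i) (n := n)
      (hM'gr := (fun K => (hMc K).mono fun B hB i => le_trans (hB i) (Nat.le_mul_of_pos_left _ hL0)))
      (hlev := (fun i hi => by show n + 1 - i = n + 1 - (i + 1) + 1; omega)) (𝒱N := (VN (Roots.ctr Lc) Pn (n + 1))) (𝒱F := (𝒱F (n + 1)))
      (𝒱G := (𝒱G (n + 1))) (𝒲N := (fun μ' y' ν' y'' => (1 / 2 : ℝ) • (WN (Roots.ctr Lc) Pn (n + 1) μ' y' ν' y'' + sgnK (trK (WN (Roots.ctr Lc) Pn (n + 1) μ' y' ν' y''))))) (𝒲F := (𝒲F (n + 1))) (𝒲G := (𝒲G (n + 1))) (μ := μ) (ν := ν) (z := z)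
      (𝒲bN := fun B => (fun x w a b => ∑' e : Site (3 + 1), ((1 / 2 : ℝ) • (WN (Roots.ctr Lc) Pn (n + 1) μ 0 ν (translate (Mc B) z e) + sgnK (trK (WN (Roots.ctr Lc) Pn (n + 1) μ 0 ν (translate (Mc B) z e))))) x w a b)) (𝒲bF := fun B => (𝒲bF (n + 1)) B μ 0 ν z) (𝒲bG := fun B => (𝒲bG (n + 1)) B μ 0 ν z)
      (hM' := (fun B i => ⟨Mc B i, rfl⟩)) (κ := (fun B => ↥(pbox (Mc B)) × Fin (3 + 1))) (pμ' := (fun B a => coarsePt (Mc B) Lc a.1))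
      (mμ' := (fun B a => a.2)) (hfμ' := (fun B => coarseSlot_injective (Mc B))) (hcoarse' := (fun B => coarseSlot_range (Mc B))) (H₀ := H₀ n)
      (Q₁₀ := Q₁₀ n) (τ₁ := τ₁ n) (hH₀ := hH₀ n) (hQ₁₀ := hQ₁₀ n) (hτ₁ := hτ₁ n) (τ₂ := τ₂ n) (hτ₂ := hτ₂ n) (Q₂₀ := Q₂₀ n) (hQ₂₀ := hQ₂₀ n) (W₀ := W₀ n)
      (hW₀ := hW₀ n) (P := P n) (hP := hP n) (c := c n) (Dbar := Dbar n) (hDbar := hDbar n) (Γ := Γ n) (I := I n) (L := L n) (S := S n) (hΓ := hΓ n)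
      (hI := hI n) (hL := hL n) (hS := hS n) (𝔔₀ := 𝔔₀ n) (h𝔔₀ := h𝔔₀ n) (hv := hv n) (hhv := hhv n) (lv := lv n) (hlv := hlv n) (Xbf := Xbf n)
      (hXbf := hXbfl n) (H₁f := H₁f n) (hH₁l := fun B => H1f_linear Lc N (n + 1) (fine Lc (Mc B)) (fun i : ℕ => n + 1 - i) ((cf n) B) (w n) (c n) ((hb n) B) ((hbl n) B) ((H₁f n) B) ((hH₁f n) B)) (Q₁₁f := Q₁₁f n) (hQ₁₁f := hQ₁₁f n) (Q₂₁f := Q₂₁f n) (hQ₂₁f := hQ₂₁f n) (H₂f := H₂f n)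
      (hH₂l := hH₂l n) (hH₂r := hH₂r n) (Q₁₂f := Q₁₂f n) (hQ₁₂f := hQ₁₂f n) (Q₂₂f := Q₂₂f n) (hQ₂₂f := hQ₂₂f n) (𝔔₁f := 𝔔₁f n) (h𝔔₁ := h𝔔₁ n) (𝔔₂f := 𝔔₂f n)
      (h𝔔₂ := h𝔔₂ n) (H'₁f := H'₁f n) (hH'₁f := hH'₁f n) (H'₂f := H'₂f n) (hH'₂f := hH'₂f n) (𝔔'₁f := 𝔔'₁f n) (h𝔔'₁f := h𝔔'₁f n) (𝔔'₂f := 𝔔'₂f n)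
      (h𝔔'₂f := h𝔔'₂f n) (W₁f := W₁f n) (W₂f := W₂f n) (hW₁f := hW₁f n) (hW₂f := hW₂f n) (Db₁f := Db₁f n) (Db₂f := Db₂f n) (hDb₁f := hDb₁f n)
      (hDb₂f := hDb₂f n) (Y₁f := fun B _ => 0) (Y₂f := Y₂f n) (Gw₁f := Gw₁f n) (hGw₁f := hGw₁f n) (Gw₂f := Gw₂f n) (hGw₂f := hGw₂f n) (hH₁t := fun B v => H1f_transpose Lc N (n + 1) (fine Lc (Mc B)) (fun i : ℕ => n + 1 - i) ((cf n) B) (w n) (c n) ((hb n) B) ((H₁f n) B) ((hH₁f n) B) v)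
      (hH₂t := hH₂t n) (a1 := fun B v => a1_row Lc N hLc2 (ctrOff_mem_box (d := 3 + 1) hL1) (n + 1) (fine Lc (Mc B)) (fun i : ℕ => n + 1 - i) (fun k => towerTorus Lc (Mc B) k) (fun k i => towerTorus_fine_apply_eq (Mc B) k i) ((cf n) B) ((hcf n) B) (w n) (κ n) ((hκ n)) ((hκn n)) ((hb n) B) (toSite rH) (c n) ((K1 n) B) ((hlink n) B) (n + 1 - (n + 1)) (Nat.sub_self _) ((hH₀ n) B) ((hW₀ n) B) ((W₁f n) B) (fun v => by rw [(hW₁f n) B v, ← (hbtop n) B v]) ((H₁f n) B) ((hH₁f n) B) ((𝔔₀ n) B) v) (a2 := a2 n) (σ := (Fin 2)) (dv := (fun B => ![(dv n) B (μ, 0), (dv n) B (ν, z)])) (a₁ := 0) (a₂ := 1) (XN := XN n)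
      (hXN := hXN n) (ρN := ρN n) (LNc := Lc ^ (n + 1 + 1)) (fN := fN n) (hfN := hfNi n) (hmN := hmN n) (hcN := hcN n) (AN := (AN (Roots.ctr Lc) (n + 1))) (hAN := hA)
      (hαN := hδA)
      (hANsh := (fun t => by rw [show (((Lc ^ (n + 2) : ℕ) : ℤ) • t) = -((((Lc ^ (n + 1 + 1) : ℕ) : ℤ)) • (-t)) by rw [smul_neg, neg_neg]]; exact shiftK_compChart (d := 3) hL1 (rc := (Roots.ctr Lc).rc) (n + 1 + 1) (s := (Roots.ctr Lc).s (n + 1 + 1)) (-t)))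
      (hEAN := hEAN n) (hAEN := hAEN n) (hLN := hLN n) (pN := ((((NN n : ℕ) : ℤ)) • (0 : Fin (3 + 1) → ℤ)))
      (pN' := ((((NN n : ℕ) : ℤ)) • (0 : Fin (3 + 1) → ℤ))) (qN := ((((NN n : ℕ) : ℤ)) • z)) (qN' := ((((NN n : ℕ) : ℤ)) • z)) (CvN := (CvN n))
      (CvN' := (CvN n)) (CwN := (CwN n)) (δN := (δN n)) (hVN := (hVN n μ 0)) (hVN' := (hVN n ν z)) (hWN := (vertexFamily₂_evenHalf_of_swap (fun μ' y' ν' y'' => WN_swap (Roots.ctr Lc) Pn (n + 1) μ' y' ν' y'') (hWN n) μ 0 ν z)) (hδN := (hδN n))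
      (hVNm := (hVNm n μ 0)) (hVNt := (hVNt n μ 0)) (hVN'm := (hVNm n ν z)) (hVN't := (hVNt n ν z)) (hWNw := (hWNw n μ ν z)) (hWNm := (hWNm_rows_wound Mc Pn fN hmN n μ 0 ν z)) (hWNt := (hWNt_rows_wound Mc Pn fN hmN n μ 0 ν z))
      (hHN₁ := (hHN₁ n μ 0)) (hQN₁ := (hQN₁ n μ 0)) (hHN₁' := (hHN₁ n ν z)) (hQN₁' := (hQN₁ n ν z)) (hHN₂ := (hHN₂ n μ 0 ν z)) (hQN₂ := (hQN₂ n μ 0 ν z))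
      (XF := XF n) (hXF := hXF n) (ρF := ρF n) (LFc := LFc n) (fF := fF n) (hfF := hfF n) (hmF := hmF n) (hcF := hcF n) (AF := (AF (n + 1))) (CAF := CAF n)
      (αF := αF n) (hAF := hAF n) (hαF := hαF n) (hAFsh := hAFsh n) (hEAF := hEAF n) (hAEF := hAEF n) (hLF := hLF n)
      (pF := ((((NF n : ℕ) : ℤ)) • (0 : Fin (3 + 1) → ℤ))) (pF' := ((((NF n : ℕ) : ℤ)) • (0 : Fin (3 + 1) → ℤ))) (qF := ((((NF n : ℕ) : ℤ)) • z))
      (qF' := ((((NF n : ℕ) : ℤ)) • z)) (CvF := (CvF n)) (CvF' := (CvF n)) (CwF := (CwF n)) (δF := (δF n)) (hVF := (hVF n μ 0)) (hVF' := (hVF n ν z))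
      (hWF := (hWF n μ 0 ν z)) (hδF := (hδF n)) (hWFw := (hWFw n μ ν z)) (hVFm := (hVFm n μ 0)) (hVFt := (hVFt n μ 0)) (hVF'm := (hVFm n ν z)) (hVF't := (hVFt n ν z))
      (hWFm := (hWFm n μ 0 ν z)) (hWFt := (hWFt n μ 0 ν z)) (hHF₁ := (hHF₁ n μ 0)) (hQF₁ := (hQF₁ n μ 0)) (hHF₁' := (hHF₁ n ν z)) (hQF₁' := (hQF₁ n ν z))
      (hHF₂ := (hHF₂ n μ 0 ν z)) (hQF₂ := (hQF₂ n μ 0 ν z)) (pG := ((((NG n : ℕ) : ℤ)) • (0 : Fin (3 + 1) → ℤ)))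
      (pG' := ((((NG n : ℕ) : ℤ)) • (0 : Fin (3 + 1) → ℤ))) (qG := ((((NG n : ℕ) : ℤ)) • z)) (qG' := ((((NG n : ℕ) : ℤ)) • z)) (CvG := (CvG n))
      (CvG' := (CvG n)) (CwG := (CwG n)) (δG := (δG n)) (hVG := (hVG n μ 0)) (hVG' := (hVG n ν z)) (hWG := (hWG n μ 0 ν z)) (hδG := (hδG n)) (hWGw := (hWGw n μ ν z))
      (hVGm := (hVGm n μ 0)) (hVGt := (hVGt n μ 0)) (hVG'm := (hVGm n ν z)) (hVG't := (hVGt n ν z)) (hWGm := (hWGm n μ 0 ν z)) (hWGt := (hWGt n μ 0 ν z))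
      (hHG₁ := (hHG₁ n μ 0)) (hQG₁ := (hQG₁ n μ 0)) (hHG₁' := (hHG₁ n ν z)) (hQG₁' := (hQG₁ n ν z)) (hHG₂ := (hHG₂ n μ 0 ν z)) (hQG₂ := (hQG₂ n μ 0 ν z))

  rw [hessKer_WN_even] at key; exact key

end Summit.QuantumFields.BalabanUV.Beta.FP.StepRecursionFeedNestedNamedF
end
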